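import Literature.MathematicalPhysics.QuantumFieldTheory.Balaban1983to89.B4Ineq110LpChain
import Literature.MathematicalPhysics.QuantumFieldTheory.Balaban1983to89.B4Ineq112WalkRoute

/-!
# `Balaban1983to89.B4Ineq112LpChain` — [Balaban1983RegularityDecay] THEOREM (1.11)–(1.12), value member, FOR A
# GENERAL PAIR OF REGIONS `Ω ⊂ Ω₀` UNDER `dist(x, Ω^c) ≥ R₀`: the printed cancellation of the two walk expansions
# (p. 579) carried through the mixed `L^p` chain (2.18)–(2.22) on the concrete operators

statement-level skeleton of published theorems with citation tags; proofs where landed; nothing here is a claim about the Yang–Mills mass gap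

CITATION HEADER.  T. Bałaban, *Regularity and decay of lattice Green's functions*, Commun. Math. Phys. **89** (1983)
571–597, doi:10.1007/bf01214744 [Balaban1983RegularityDecay] (cell paper B4; held text
`paper:balaban1983-cmp89-regularity-decay`, journal page = PDF page + 570; pp. 573, 577–579, 581).  Unit
`lit-balaban-r01` gen 6 (B4 fold owner), HOME `run/shared/lean/pub/lit-balaban/`, SKELETON rows **B4.Thm@573**
((1.11)–(1.12) value member, general `Ω ⊂ Ω₀`, `R₀`), **B4.Cor2.3** (δG clause), **B4.Eq2.18**, **B4.Eq2.12**.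
Theorems only; imports `B4Ineq110LpChain` (the chain with convergence from the estimates: `lpv`, `lvl`,
`neumann_partial`, `lpv_two_R_pow_mulVec_le`) and `B4Ineq112WalkRoute` (the two-family setting:
`interior_letters_agree`); through them `B4RandomWalkDelta112` (`Avoids`, `path_term_congr_off`,
`le_length_of_through`) and `B4LpChain221` (`walk_term_bound`, `good_of_reach`, `tail_222`).

WHAT IS PRINTED (p. 579, verbatim).  *«To prove the corresponding inequalities for δG_k(Ω,Ω₀,A) = G_k(Ω,A) − G_k(Ω₀,A)
with Ω ⊂ Ω₀, we take the representations (2.13) for both propagators. The terms with ω such that □_{ω_i} are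
interior cubes of Ω are the same in both representations, so they cancel in the difference, and for δG_k we get a
representation similar to (2.13) with the additional restriction that at least one □_{ω_i} intersects the boundary
∂Ω. We estimate the terms of the representation as above and we get the first inequality in (2.22) with 2^{d+1}
instead of 2^d and with the restriction n ≥ M⁻¹ sup_{x₁∈Ω^c}(dist({x,x′},x₁) + dist(x₁,supp f)) − 3
≥ (2M)⁻¹(dist({x,x′}, supp f) + dist({x,x′}, Ω^c) + dist(supp f, Ω^c)) − 3. It implies all the inequalities we
need.»*  («as above» = the mixed `L^p` chain (2.18)–(2.21) with the restriction `dist({x,x′},Ω^c) ≥ R₀`.)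

WHAT THIS MODULE PROVES (all in full).
* §1 ABSTRACT (any ring `R` acting on a module `E`; no topology): `diff_order_vec_eq` (the order-`n` vector of the
  difference is the sum over walks NOT avoiding `T` of the differences of the two path terms — the cancellation),
  **`lp_walk_delta_bound_rem`** (two local families agreeing off `T`, both identities `G = G₀ + GR`,
  `G′ = G₀′ + G′R′` with decaying remainders, `Φ` subadditive with `Φ(x − y) ≤ Φ x + Φ y`, the first-letter and
  graded/`L²`/sup chain inputs of `B4LpChain221.walk_term_bound` for BOTH families, walks from `S₀` into `S₁`
  through `T` of length `≥ N`):  `Φ((G − G′)•f) ≤ 2·|S₀|c₁V(Dβ)^N/(1 − Dβ)·‖f‖_∞`; `lp_walk_delta_bound_rem_exp`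
  (`Dβ ≤ e⁻¹`, `N ≥ r − 2`: `≤ 4|S₀|c₁Ve²e^{−r}‖f‖_∞`); **`lattice_lp_walk_delta_bound_rem`** (cube adjacency,
  `R₀` in label form, separation through `T`).
* §2 CONCRETE, setting of `B4Ineq112WalkRoute.ineq112_value` (sites `X` of `Ω₀`, `H = covOp c m² a q W T` with
  inverse `G′ = G_k(Ω₀,A)`, the sub-region `Ω` through the Neumann cut `c^Ω` with inverse `G`, block-compatible
  cube sets `S_j`, cube propagators `G_j`, `G_j^Ω`): **`ineq112_value_lp`** — inputs in the printed norms for BOTH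
  cube families (`good` labels: `‖G_j‖, ‖G_j^Ω‖ ≤ γ`, sup factor `≤ β`, graded factors `≤ β`; all labels: `L²`
  factor `≤ β`; `3^dβ ≤ e⁻¹`; `R₀` in label form) ⇒ for `f` supported in `F × κ` with `‖f‖₂ ≤ V‖f‖_∞` and
  `D ≤ dist_∞(x,F)`, `D₀ ≤ dist_∞(x,Ω^c)`, `D₁ ≤ dist_∞(F,Ω^c)`:
  `‖1_x ⊙ ((G_k(Ω,A) − G_k(Ω₀,A))f)‖_∞ ≤ 2^{d+2}e^{17/4}γV·exp(−(D + D₀ + D₁)/(2M))·‖f‖_∞`;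
  `ineq112_value_lp_apply` (the printed shape).  Both remainders decay by `lpv_two_R_pow_mulVec_le`.
* §3 (v1.1) **`probe_delta_bound_lp`** — the same for an ARBITRARY LOCAL PROBE `P` (`P·h_j = 0` off `≤ m₀` cubes
  within `ρM` of `x₀`; first-letter inputs `α_P` for both families on those cubes):
  `‖P((G_k(Ω,A) − G_k(Ω₀,A))f)‖_∞ ≤ 4m₀α_P·V·e^{ρ+29/8}·exp(−(D + D₀ + D₁)/(2M))·‖f‖_∞` — parent of the derivative and
  Hölder members of the δG clause.
HONEST SCOPE.  Value member of the δG clause only; inputs are hypotheses in the printed norms (interior cubes: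
Lemma 2.2 at `Ã_j`; all cubes: Lemma 2.1); `Ω ⊂ Ω₀` modelled by the Neumann cut inside the common site set (as in
`B4Ineq112WalkRoute`); `R₀` via its label-space consequence for the cubes seeing `x`.  No `def`, no `Prop` fact, no
`sorry`; axioms standard.
-/

namespace Literature.MathematicalPhysics.QuantumFieldTheory.Balaban1983to89.B4Ineq112LpChain

open Literature.MathematicalPhysics.QuantumFieldTheory.Balaban1983to89.B4GaugeCovariance
open Literature.MathematicalPhysics.QuantumFieldTheory.Balaban1983to89.B4Commutators25to211
open Literature.MathematicalPhysics.QuantumFieldTheory.Balaban1983to89.B4PartitionUnity22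
open Literature.MathematicalPhysics.QuantumFieldTheory.Balaban1983to89.B4RandomWalk213
open Literature.MathematicalPhysics.QuantumFieldTheory.Balaban1983to89.B4RandomWalkDelta112
open Literature.MathematicalPhysics.QuantumFieldTheory.Balaban1983to89.B4LpChain221
open Literature.MathematicalPhysics.QuantumFieldTheory.Balaban1983to89.B4Eq213Locality
open Literature.MathematicalPhysics.QuantumFieldTheory.Balaban1983to89.B4Eq26Locality
open Literature.MathematicalPhysics.QuantumFieldTheory.Balaban1983to89.B4Eq213ConcreteWalk
open Literature.MathematicalPhysics.QuantumFieldTheory.Balaban1983to89.B4Eq212SmallR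
open Literature.MathematicalPhysics.QuantumFieldTheory.Balaban1983to89.B4Ineq110WalkRoute
open Literature.MathematicalPhysics.QuantumFieldTheory.Balaban1983to89.B4Ineq112WalkRoute
open Literature.MathematicalPhysics.QuantumFieldTheory.Balaban1983to89.B4Ineq110LpChain
open scoped Matrix NNReal
open scoped Matrix.Norms.Operator

/-! ## §1. The cancellation of the two expansions through the chain, abstractly -/

section Abstract

variable {R : Type*} [Ring R] {E : Type*} [AddCommGroup E] [Module R E] {ι : Type*} [Fintype ι] [DecidableEq ι]

/-- **THE CANCELLATION ON VECTORS**: for two LOCAL factor families agreeing off `T`, the order-`n` vector of the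
difference of the two expansions applied to `f` is the sum over the walks NOT avoiding `T` of the differences of
the two path terms — *«The terms with ω such that □_{ω_i} are interior cubes of Ω are the same in both
representations, so they cancel in the difference»*. [cite: Balaban1983RegularityDecay, p.579 after (2.22); (2.13) p.577] -/
theorem diff_order_vec_eq (adj : ι → ι → Prop) [DecidableRel adj] {a b a' b' : ι → R} {T : Finset ι}
    (hab : ∀ i l, ¬ adj i l → a i * b l = 0) (hbb : ∀ i l, ¬ adj i l → b i * b l = 0)
    (hab' : ∀ i l, ¬ adj i l → a' i * b' l = 0) (hbb' : ∀ i l, ¬ adj i l → b' i * b' l = 0)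
    (ha : ∀ i ∉ T, a i = a' i) (hb : ∀ i ∉ T, b i = b' i) (f : E) (n : ℕ) :
    ((∑ i, a i) * (∑ i, b i) ^ n - (∑ i, a' i) * (∑ i, b' i) ^ n) • f =
      ∑ i, ∑ ys ∈ (walks adj i n).filter (fun ys => ¬ Avoids T i ys),
        ((a i * bprod b n ys) • f - (a' i * bprod b' n ys) • f) := by
  rw [sub_smul, order_vec_eq_sum_walks adj hab hbb f n, order_vec_eq_sum_walks adj hab' hbb' f n,
    ← Finset.sum_sub_distrib]
  refine Finset.sum_congr rfl fun i _ => ?_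
  rw [← Finset.sum_sub_distrib]
  refine (Finset.sum_filter_of_ne fun ys _ hne => ?_).symm
  intro hav
  refine hne ?_
  rw [path_term_congr_off ha hb hav, sub_self]

/-- **THE δG_k BOUND THROUGH THE MIXED `L^p` CHAIN, ABSTRACT FORM, CONVERGENCE FROM THE ESTIMATES.**  Two local
factor families `(a,b)`, `(a′,b′)` over the same labels agreeing off `T`; both expansions in the printed sense
(`G = G₀ + G·R`, `G′ = G₀′ + G′·R′`, the remainders `Φ((GR^m)f) + Φ((G′R′^m)f) → 0`); a subadditive target
functional `Φ` with `Φ(x − y) ≤ Φ x + Φ y`, `≤ 0` after `a i`, `a′ i` off `S₀` and `≤ c₁‖·‖_∞` after them on `S₀`;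
`f` killed off `S₁` by all four letter families, `‖f‖₂ ≤ V‖f‖_∞`; the graded bounds of Lemma 2.2 at good labels and
the `L²` bound of Lemma 2.1 at all labels for BOTH families; walks from `S₀` meet good labels at positions `≤ n₀`;
out-degree `≤ D`, `Dβ < 1`; every walk from `S₀` into `S₁` NOT avoiding `T` has `≥ N` steps.  Then
`Φ((G − G′) • f) ≤ 2·(|S₀|·c₁·V·(Dβ)^N/(1 − Dβ)·‖f‖_∞)` — *«2^{d+1} instead of 2^d»*.
[cite: Balaban1983RegularityDecay, p.579 after (2.22); (2.18)–(2.21) p.578; (1.11)–(1.12) p.573] -/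
theorem lp_walk_delta_bound_rem (adj : ι → ι → Prop) [DecidableRel adj]
    {a b a' b' : ι → R} {G G' G₀ G₀' Rop Rop' : R} {f : E} {Φ : E → ℝ} {nrm : ℕ → E → ℝ} {good : ι → Prop}
    {S₀ S₁ T : Finset ι} {c₁ β : ℝ} {D N n₀ : ℕ}
    (hG₀ : G₀ = ∑ i, a i) (hRop : Rop = ∑ i, b i) (hG₀' : G₀' = ∑ i, a' i) (hRop' : Rop' = ∑ i, b' i)
    (hG : G = G₀ + G * Rop) (hG' : G' = G₀' + G' * Rop')
    (hrem : ∀ ε : ℝ, 0 < ε → ∃ m : ℕ, Φ ((G * Rop ^ m) • f) + Φ ((G' * Rop' ^ m) • f) ≤ ε)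
    (hab : ∀ i l, ¬ adj i l → a i * b l = 0) (hbb : ∀ i l, ¬ adj i l → b i * b l = 0)
    (hab' : ∀ i l, ¬ adj i l → a' i * b' l = 0) (hbb' : ∀ i l, ¬ adj i l → b' i * b' l = 0)
    (haT : ∀ i ∉ T, a i = a' i) (hbT : ∀ i ∉ T, b i = b' i)
    (hΦ0 : Φ 0 ≤ 0) (hΦadd : ∀ x y, Φ (x + y) ≤ Φ x + Φ y) (hΦsub : ∀ x y, Φ (x - y) ≤ Φ x + Φ y)
    (hS₀ : ∀ i ∉ S₀, ∀ g : E, Φ (a i • g) ≤ 0) (hS₀' : ∀ i ∉ S₀, ∀ g : E, Φ (a' i • g) ≤ 0)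
    (hS₁a : ∀ i ∉ S₁, a i • f = 0) (hS₁b : ∀ i ∉ S₁, b i • f = 0)
    (hS₁a' : ∀ i ∉ S₁, a' i • f = 0) (hS₁b' : ∀ i ∉ S₁, b' i • f = 0)
    (hc₁ : 0 ≤ c₁) (ha : ∀ i ∈ S₀, ∀ g : E, Φ (a i • g) ≤ c₁ * nrm 0 g)
    (ha' : ∀ i ∈ S₀, ∀ g : E, Φ (a' i • g) ≤ c₁ * nrm 0 g)
    (hβ : 0 ≤ β)
    (hgr : ∀ j, good j → ∀ i, 1 ≤ i → i ≤ n₀ → ∀ g : E, nrm (i - 1) (b j • g) ≤ β * nrm i g)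
    (h2 : ∀ (j) (g : E), nrm n₀ (b j • g) ≤ β * nrm n₀ g)
    (h0 : ∀ j, good j → ∀ g : E, nrm 0 (b j • g) ≤ β * nrm 0 g)
    (hgr' : ∀ j, good j → ∀ i, 1 ≤ i → i ≤ n₀ → ∀ g : E, nrm (i - 1) (b' j • g) ≤ β * nrm i g)
    (h2' : ∀ (j) (g : E), nrm n₀ (b' j • g) ≤ β * nrm n₀ g)
    (h0' : ∀ j, good j → ∀ g : E, nrm 0 (b' j • g) ≤ β * nrm 0 g)
    {V : ℝ} (hV : 1 ≤ V) (h2inf : nrm n₀ f ≤ V * nrm 0 f) (hnrm : 0 ≤ nrm 0 f)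
    (hgood : ∀ (n : ℕ) (i : ι), i ∈ S₀ → ∀ ys : Fin n → ι, IsWalk adj i ys →
      ∀ t : Fin n, (t : ℕ) + 1 ≤ n₀ → good (ys t))
    (hD : ∀ j, (Finset.univ.filter fun i => adj j i).card ≤ D) (hDβ : (D : ℝ) * β < 1)
    (hsepT : ∀ (n : ℕ) (i : ι), i ∈ S₀ → ∀ ys : Fin n → ι, IsWalk adj i ys → lastPt i n ys ∈ S₁ →
      ¬ Avoids T i ys → N ≤ n) :
    Φ ((G - G') • f) ≤ 2 * (S₀.card * c₁ * V * ((D : ℝ) * β) ^ N / (1 - D * β) * nrm 0 f) := by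
  subst hG₀ hRop hG₀' hRop'
  have hVn : 0 ≤ V * nrm 0 f := mul_nonneg (zero_le_one.trans hV) hnrm
  set K : ℝ := S₀.card * c₁ * (V * nrm 0 f) with hK
  have hK0 : 0 ≤ K := mul_nonneg (mul_nonneg (Nat.cast_nonneg _) hc₁) hVn
  have hr0 : 0 ≤ (D : ℝ) * β := mul_nonneg (Nat.cast_nonneg _) hβ
  -- each path term of each family: `Φ ≤ c₁βⁿV‖f‖_∞` (the chain, `walk_term_bound` with no length restriction)
  have hterm := walk_term_bound adj (N := 0) hΦ0 hS₀ hS₁a hS₁b hc₁ ha hβ hgr h2 h0 hV h2inf hnrm hgood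
    (fun n i _ ys _ _ => Nat.zero_le n)
  have hterm' := walk_term_bound adj (N := 0) hΦ0 hS₀' hS₁a' hS₁b' hc₁ ha' hβ hgr' h2' h0' hV h2inf hnrm hgood
    (fun n i _ ys _ _ => Nat.zero_le n)
  -- the order-n term of the difference: `≤ 2K(Dβ)ⁿ` for `n ≥ N`, else `≤ 0`
  have horder : ∀ n : ℕ, Φ ((((∑ i, a i) * (∑ i, b i) ^ n - (∑ i, a' i) * (∑ i, b' i) ^ n)) • f) ≤
      if N ≤ n then 2 * K * ((D : ℝ) * β) ^ n else 0 := fun n => by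
    rw [diff_order_vec_eq adj hab hbb hab' hbb' haT hbT f n]
    have hpt : ∀ (i : ι) (ys : Fin n → ι), ys ∈ (walks adj i n).filter (fun ys => ¬ Avoids T i ys) →
        Φ ((a i * bprod b n ys) • f - (a' i * bprod b' n ys) • f)
          ≤ if i ∈ S₀ then (if N ≤ n then 2 * (c₁ * β ^ n * (V * nrm 0 f)) else 0) else 0 := by
      intro i ys hys
      rw [Finset.mem_filter, mem_walks] at hys
      by_cases hi : i ∈ S₀
      · rw [if_pos hi]
        by_cases hNn : N ≤ n
        · rw [if_pos hNn, two_mul]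
          refine (hΦsub _ _).trans (add_le_add ?_ ?_)
          · have h := hterm n i ys hys.1
            rwa [if_pos (Nat.zero_le n)] at h
          · have h := hterm' n i ys hys.1
            rwa [if_pos (Nat.zero_le n)] at h
        · -- `n < N`: the walk goes through `T`, so it cannot end in `S₁`; both terms vanish
          rw [if_neg hNn]
          have hl : lastPt i n ys ∉ S₁ := fun hl => hNn (hsepT n i hi ys hys.1 hl hys.2)
          have hz : ∀ {a₁ b₁ : ι → R}, (∀ i ∉ S₁, a₁ i • f = 0) → (∀ i ∉ S₁, b₁ i • f = 0) →
              (a₁ i * bprod b₁ n ys) • f = 0 := by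
            intro a₁ b₁ h1a h1b
            cases n with
            | zero =>
                rw [lastPt_zero] at hl
                rw [bprod_zero, mul_one, h1a i hl]
            | succ m =>
                rw [mul_smul, bprod_smul_eq_zero_of_last b₁ m ys (h1b _ hl), smul_zero]
          rw [hz hS₁a hS₁b, hz hS₁a' hS₁b', sub_zero]
          exact hΦ0
      · rw [if_neg hi, mul_smul, mul_smul]
        exact (hΦsub _ _).trans (by linarith [hS₀ i hi (bprod b n ys • f), hS₀' i hi (bprod b' n ys • f)])
    calc Φ (∑ i, ∑ ys ∈ (walks adj i n).filter (fun ys => ¬ Avoids T i ys),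
            ((a i * bprod b n ys) • f - (a' i * bprod b' n ys) • f))
        ≤ ∑ i, Φ (∑ ys ∈ (walks adj i n).filter (fun ys => ¬ Avoids T i ys),
            ((a i * bprod b n ys) • f - (a' i * bprod b' n ys) • f)) :=
          Finset.le_sum_of_subadditive Φ hΦ0 hΦadd _ _
      _ ≤ ∑ i, ∑ ys ∈ (walks adj i n).filter (fun ys => ¬ Avoids T i ys),
            Φ ((a i * bprod b n ys) • f - (a' i * bprod b' n ys) • f) :=
          Finset.sum_le_sum fun i _ => Finset.le_sum_of_subadditive Φ hΦ0 hΦadd _ _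
      _ ≤ ∑ i, ∑ ys ∈ (walks adj i n).filter (fun ys => ¬ Avoids T i ys),
            (if i ∈ S₀ then (if N ≤ n then 2 * (c₁ * β ^ n * (V * nrm 0 f)) else 0) else 0) :=
          Finset.sum_le_sum fun i _ => Finset.sum_le_sum fun ys hys => hpt i ys hys
      _ = ∑ i ∈ S₀, ∑ _ys ∈ (walks adj i n).filter (fun ys => ¬ Avoids T i ys),
            (if N ≤ n then 2 * (c₁ * β ^ n * (V * nrm 0 f)) else 0) := by
          rw [← Finset.sum_subset (Finset.subset_univ S₀) (fun i _ hi => by rw [if_neg hi]; simp)]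
          exact Finset.sum_congr rfl fun i hi => by rw [if_pos hi]
      _ ≤ ∑ _i ∈ S₀, (D : ℝ) ^ n * (if N ≤ n then 2 * (c₁ * β ^ n * (V * nrm 0 f)) else 0) := by
          refine Finset.sum_le_sum fun i _ => ?_
          rw [Finset.sum_const, nsmul_eq_mul]
          refine mul_le_mul_of_nonneg_right ?_ ?_
          · exact_mod_cast (Finset.card_le_card (Finset.filter_subset _ _)).trans (card_walks_le adj hD n i)
          · split_ifs
            · exact mul_nonneg zero_le_two (mul_nonneg (mul_nonneg hc₁ (pow_nonneg hβ n)) hVn)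
            · exact le_rfl
      _ = if N ≤ n then 2 * K * ((D : ℝ) * β) ^ n else 0 := by
          rw [Finset.sum_const, nsmul_eq_mul, hK]
          split_ifs
          · ring
          · simp
  -- the majorant series: Σ_{n ≥ N} 2K (Dβ)ⁿ = 2K (Dβ)^N / (1 − Dβ)
  have hgeo : HasSum (fun n : ℕ => if N ≤ n then 2 * K * ((D : ℝ) * β) ^ n else 0)
      (2 * K * ((D : ℝ) * β) ^ N / (1 - D * β)) := by
    have h1 : HasSum (fun m : ℕ => 2 * K * ((D : ℝ) * β) ^ N * ((D : ℝ) * β) ^ m)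
        (2 * K * ((D : ℝ) * β) ^ N * (1 - (D : ℝ) * β)⁻¹) :=
      (hasSum_geometric_of_lt_one hr0 hDβ).mul_left _
    refine (hasSum_nat_add_iff' N).mp ?_
    have hz : ∑ i ∈ Finset.range N, (if N ≤ i then 2 * K * ((D : ℝ) * β) ^ i else 0) = 0 :=
      Finset.sum_eq_zero fun i hi => by rw [if_neg (not_le.mpr (Finset.mem_range.mp hi))]
    rw [hz, sub_zero, div_eq_mul_inv]
    refine h1.congr_fun fun m => ?_
    show (if N ≤ m + N then 2 * K * ((D : ℝ) * β) ^ (m + N) else 0)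
      = 2 * K * ((D : ℝ) * β) ^ N * ((D : ℝ) * β) ^ m
    rw [if_pos (Nat.le_add_left N m), pow_add]
    ring
  have hpartial : ∀ m : ℕ, Φ (∑ n ∈ Finset.range m,
      (((∑ i, a i) * (∑ i, b i) ^ n - (∑ i, a' i) * (∑ i, b' i) ^ n)) • f) ≤
      2 * K * ((D : ℝ) * β) ^ N / (1 - D * β) := fun m =>
    calc Φ (∑ n ∈ Finset.range m, (((∑ i, a i) * (∑ i, b i) ^ n - (∑ i, a' i) * (∑ i, b' i) ^ n)) • f)
        ≤ ∑ n ∈ Finset.range m, Φ ((((∑ i, a i) * (∑ i, b i) ^ n - (∑ i, a' i) * (∑ i, b' i) ^ n)) • f) :=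
          Finset.le_sum_of_subadditive Φ hΦ0 hΦadd _ _
      _ ≤ ∑ n ∈ Finset.range m, (if N ≤ n then 2 * K * ((D : ℝ) * β) ^ n else 0) :=
          Finset.sum_le_sum fun n _ => horder n
      _ ≤ 2 * K * ((D : ℝ) * β) ^ N / (1 - D * β) :=
          sum_le_hasSum _ (fun n _ => by
            split_ifs <;> [exact mul_nonneg (mul_nonneg zero_le_two hK0) (pow_nonneg hr0 n); exact le_rfl]) hgeo
  -- `(G − G′)•f = Σ_{n<m}(order-n difference)•f + ((GR^m)•f − (G′R′^m)•f)` and the remainders are small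
  refine le_of_forall_pos_le_add fun ε hε => ?_
  obtain ⟨m, hm⟩ := hrem ε hε
  have hsplit : (G - G') • f
      = (∑ n ∈ Finset.range m, (((∑ i, a i) * (∑ i, b i) ^ n - (∑ i, a' i) * (∑ i, b' i) ^ n)) • f)
        + ((G * (∑ i, b i) ^ m) • f - (G' * (∑ i, b' i) ^ m) • f) := by
    rw [sub_smul, ← Finset.sum_smul, Finset.sum_sub_distrib, sub_smul]
    conv_lhs => rw [neumann_partial hG m, neumann_partial hG' m]
    rw [add_smul, add_smul]
    abel
  calc Φ ((G - G') • f)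
      ≤ Φ (∑ n ∈ Finset.range m, (((∑ i, a i) * (∑ i, b i) ^ n - (∑ i, a' i) * (∑ i, b' i) ^ n)) • f)
        + Φ ((G * (∑ i, b i) ^ m) • f - (G' * (∑ i, b' i) ^ m) • f) := by rw [hsplit]; exact hΦadd _ _
    _ ≤ 2 * K * ((D : ℝ) * β) ^ N / (1 - D * β) + ε :=
        add_le_add (hpartial m) ((hΦsub _ _).trans hm)
    _ = 2 * (S₀.card * c₁ * V * ((D : ℝ) * β) ^ N / (1 - D * β) * nrm 0 f) + ε := by rw [hK]; ring

/-- **EXPONENTIAL FORM**: `Dβ ≤ e⁻¹`, `N ≥ r − 2` ⇒ `Φ((G − G′)•f) ≤ 4|S₀|c₁Ve²e^{−r}‖f‖_∞` (`B4LpChain221.tail_222`).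
[cite: Balaban1983RegularityDecay, (2.22) p.579, p.579 after (2.22)] -/
theorem lp_walk_delta_bound_rem_exp (adj : ι → ι → Prop) [DecidableRel adj]
    {a b a' b' : ι → R} {G G' G₀ G₀' Rop Rop' : R} {f : E} {Φ : E → ℝ} {nrm : ℕ → E → ℝ} {good : ι → Prop}
    {S₀ S₁ T : Finset ι} {c₁ β r : ℝ} {D N n₀ : ℕ}
    (hG₀ : G₀ = ∑ i, a i) (hRop : Rop = ∑ i, b i) (hG₀' : G₀' = ∑ i, a' i) (hRop' : Rop' = ∑ i, b' i)
    (hG : G = G₀ + G * Rop) (hG' : G' = G₀' + G' * Rop')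
    (hrem : ∀ ε : ℝ, 0 < ε → ∃ m : ℕ, Φ ((G * Rop ^ m) • f) + Φ ((G' * Rop' ^ m) • f) ≤ ε)
    (hab : ∀ i l, ¬ adj i l → a i * b l = 0) (hbb : ∀ i l, ¬ adj i l → b i * b l = 0)
    (hab' : ∀ i l, ¬ adj i l → a' i * b' l = 0) (hbb' : ∀ i l, ¬ adj i l → b' i * b' l = 0)
    (haT : ∀ i ∉ T, a i = a' i) (hbT : ∀ i ∉ T, b i = b' i)
    (hΦ0 : Φ 0 ≤ 0) (hΦadd : ∀ x y, Φ (x + y) ≤ Φ x + Φ y) (hΦsub : ∀ x y, Φ (x - y) ≤ Φ x + Φ y)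
    (hS₀ : ∀ i ∉ S₀, ∀ g : E, Φ (a i • g) ≤ 0) (hS₀' : ∀ i ∉ S₀, ∀ g : E, Φ (a' i • g) ≤ 0)
    (hS₁a : ∀ i ∉ S₁, a i • f = 0) (hS₁b : ∀ i ∉ S₁, b i • f = 0)
    (hS₁a' : ∀ i ∉ S₁, a' i • f = 0) (hS₁b' : ∀ i ∉ S₁, b' i • f = 0)
    (hc₁ : 0 ≤ c₁) (ha : ∀ i ∈ S₀, ∀ g : E, Φ (a i • g) ≤ c₁ * nrm 0 g)
    (ha' : ∀ i ∈ S₀, ∀ g : E, Φ (a' i • g) ≤ c₁ * nrm 0 g)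
    (hβ : 0 ≤ β)
    (hgr : ∀ j, good j → ∀ i, 1 ≤ i → i ≤ n₀ → ∀ g : E, nrm (i - 1) (b j • g) ≤ β * nrm i g)
    (h2 : ∀ (j) (g : E), nrm n₀ (b j • g) ≤ β * nrm n₀ g)
    (h0 : ∀ j, good j → ∀ g : E, nrm 0 (b j • g) ≤ β * nrm 0 g)
    (hgr' : ∀ j, good j → ∀ i, 1 ≤ i → i ≤ n₀ → ∀ g : E, nrm (i - 1) (b' j • g) ≤ β * nrm i g)
    (h2' : ∀ (j) (g : E), nrm n₀ (b' j • g) ≤ β * nrm n₀ g)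
    (h0' : ∀ j, good j → ∀ g : E, nrm 0 (b' j • g) ≤ β * nrm 0 g)
    {V : ℝ} (hV : 1 ≤ V) (h2inf : nrm n₀ f ≤ V * nrm 0 f) (hnrm : 0 ≤ nrm 0 f)
    (hgood : ∀ (n : ℕ) (i : ι), i ∈ S₀ → ∀ ys : Fin n → ι, IsWalk adj i ys →
      ∀ t : Fin n, (t : ℕ) + 1 ≤ n₀ → good (ys t))
    (hD : ∀ j, (Finset.univ.filter fun i => adj j i).card ≤ D) (hDβ : (D : ℝ) * β ≤ Real.exp (-1))
    (hsepT : ∀ (n : ℕ) (i : ι), i ∈ S₀ → ∀ ys : Fin n → ι, IsWalk adj i ys → lastPt i n ys ∈ S₁ →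
      ¬ Avoids T i ys → N ≤ n)
    (hN : r - 2 ≤ N) :
    Φ ((G - G') • f) ≤ 4 * S₀.card * c₁ * V * Real.exp 2 * Real.exp (-r) * nrm 0 f := by
  have hlt : (D : ℝ) * β < 1 := hDβ.trans_lt (Real.exp_lt_one_iff.mpr (by norm_num))
  have h := lp_walk_delta_bound_rem adj hG₀ hRop hG₀' hRop' hG hG' hrem hab hbb hab' hbb' haT hbT hΦ0 hΦadd hΦsub
    hS₀ hS₀' hS₁a hS₁b hS₁a' hS₁b' hc₁ ha ha' hβ hgr h2 h0 hgr' h2' h0' hV h2inf hnrm hgood hD hlt hsepT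
  have ht := tail_222 (mul_nonneg (Nat.cast_nonneg D) hβ) hDβ hN
  have hK : 0 ≤ (S₀.card : ℝ) * c₁ * V := mul_nonneg (mul_nonneg (Nat.cast_nonneg _) hc₁) (zero_le_one.trans hV)
  calc Φ ((G - G') • f) ≤ 2 * (S₀.card * c₁ * V * ((D : ℝ) * β) ^ N / (1 - D * β) * nrm 0 f) := h
    _ = 2 * (S₀.card * c₁ * V * (((D : ℝ) * β) ^ N / (1 - D * β)) * nrm 0 f) := by ring
    _ ≤ 2 * (S₀.card * c₁ * V * (2 * Real.exp 2 * Real.exp (-r)) * nrm 0 f) :=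
        mul_le_mul_of_nonneg_left (mul_le_mul_of_nonneg_right (mul_le_mul_of_nonneg_left ht hK) hnrm) zero_le_two
    _ = 4 * S₀.card * c₁ * V * Real.exp 2 * Real.exp (-r) * nrm 0 f := by ring

/-- **ON `ℤ^d`**: cube adjacency (`3^d` successors, injective labels), `R₀` as «labels within `n₀` of `S₀` are
good», the length restriction from `N ≤ d(S₀,t) + d(t,S₁)` for every `t ∈ T` (`le_length_of_through`),
*«3^dc₂O(1)M⁻¹ ≤ e⁻¹»*, `N ≥ r − 2`:  `Φ((G − G′)•f) ≤ 4|S₀|c₁Ve²e^{−r}‖f‖_∞`.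
[cite: Balaban1983RegularityDecay, p.579 after (2.22); (1.11)–(1.12) p.573; Corollary 2.3 p.581] -/
theorem lattice_lp_walk_delta_bound_rem {d : ℕ} (pos : ι → Fin d → ℤ) (hpos : Function.Injective pos)
    {a b a' b' : ι → R} {G G' G₀ G₀' Rop Rop' : R} {f : E} {Φ : E → ℝ} {nrm : ℕ → E → ℝ} {good : ι → Prop}
    {S₀ S₁ T : Finset ι} {c₁ β r : ℝ} {N n₀ : ℕ}
    (hG₀ : G₀ = ∑ i, a i) (hRop : Rop = ∑ i, b i) (hG₀' : G₀' = ∑ i, a' i) (hRop' : Rop' = ∑ i, b' i)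
    (hG : G = G₀ + G * Rop) (hG' : G' = G₀' + G' * Rop')
    (hrem : ∀ ε : ℝ, 0 < ε → ∃ m : ℕ, Φ ((G * Rop ^ m) • f) + Φ ((G' * Rop' ^ m) • f) ≤ ε)
    (hab : ∀ i l, ¬ cubeAdj pos i l → a i * b l = 0) (hbb : ∀ i l, ¬ cubeAdj pos i l → b i * b l = 0)
    (hab' : ∀ i l, ¬ cubeAdj pos i l → a' i * b' l = 0) (hbb' : ∀ i l, ¬ cubeAdj pos i l → b' i * b' l = 0)
    (haT : ∀ i ∉ T, a i = a' i) (hbT : ∀ i ∉ T, b i = b' i)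
    (hΦ0 : Φ 0 ≤ 0) (hΦadd : ∀ x y, Φ (x + y) ≤ Φ x + Φ y) (hΦsub : ∀ x y, Φ (x - y) ≤ Φ x + Φ y)
    (hS₀ : ∀ i ∉ S₀, ∀ g : E, Φ (a i • g) ≤ 0) (hS₀' : ∀ i ∉ S₀, ∀ g : E, Φ (a' i • g) ≤ 0)
    (hS₁a : ∀ i ∉ S₁, a i • f = 0) (hS₁b : ∀ i ∉ S₁, b i • f = 0)
    (hS₁a' : ∀ i ∉ S₁, a' i • f = 0) (hS₁b' : ∀ i ∉ S₁, b' i • f = 0)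
    (hc₁ : 0 ≤ c₁) (ha : ∀ i ∈ S₀, ∀ g : E, Φ (a i • g) ≤ c₁ * nrm 0 g)
    (ha' : ∀ i ∈ S₀, ∀ g : E, Φ (a' i • g) ≤ c₁ * nrm 0 g)
    (hβ : 0 ≤ β)
    (hgr : ∀ j, good j → ∀ i, 1 ≤ i → i ≤ n₀ → ∀ g : E, nrm (i - 1) (b j • g) ≤ β * nrm i g)
    (h2 : ∀ (j) (g : E), nrm n₀ (b j • g) ≤ β * nrm n₀ g)
    (h0 : ∀ j, good j → ∀ g : E, nrm 0 (b j • g) ≤ β * nrm 0 g)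
    (hgr' : ∀ j, good j → ∀ i, 1 ≤ i → i ≤ n₀ → ∀ g : E, nrm (i - 1) (b' j • g) ≤ β * nrm i g)
    (h2' : ∀ (j) (g : E), nrm n₀ (b' j • g) ≤ β * nrm n₀ g)
    (h0' : ∀ j, good j → ∀ g : E, nrm 0 (b' j • g) ≤ β * nrm 0 g)
    {V : ℝ} (hV : 1 ≤ V) (h2inf : nrm n₀ f ≤ V * nrm 0 f) (hnrm : 0 ≤ nrm 0 f)
    (hR₀ : ∀ i ∈ S₀, ∀ j, (∀ μ, |pos i μ - pos j μ| ≤ n₀) → good j)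
    (h3β : (3 : ℝ) ^ d * β ≤ Real.exp (-1))
    (hsep : ∀ i ∈ S₀, ∀ t ∈ T, ∀ l ∈ S₁, ∃ μ ν, (N : ℤ) ≤ |pos i μ - pos t μ| + |pos t ν - pos l ν|)
    (hN : r - 2 ≤ N) :
    Φ ((G - G') • f) ≤ 4 * S₀.card * c₁ * V * Real.exp 2 * Real.exp (-r) * nrm 0 f :=
  lp_walk_delta_bound_rem_exp (cubeAdj pos) hG₀ hRop hG₀' hRop' hG hG' hrem hab hbb hab' hbb' haT hbT hΦ0 hΦadd
    hΦsub hS₀ hS₀' hS₁a hS₁b hS₁a' hS₁b' hc₁ ha ha' hβ hgr h2 h0 hgr' h2' h0' hV h2inf hnrm (good_of_reach pos hR₀)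
    (card_cubeAdj_le pos hpos) (D := 3 ^ d) (by exact_mod_cast h3β) (le_length_of_through pos hsep) hN

end Abstract

/-! ## §2. [B4]'s concrete operators: (1.11)–(1.12), value member, for a general pair `Ω ⊂ Ω₀` under `R₀` -/

section Route

variable {X Y κ : Type*} [Fintype X] [Fintype Y] [Fintype κ] [DecidableEq X] [DecidableEq κ] {d : ℕ}

/-- the labels that can see a site number at most `2^d`. [cite: Balaban1983RegularityDecay, §2 p.575] -/
private theorem card_labelBox_le (M : ℝ) (x : Fin d → ℝ) :
    (Fintype.piFinset fun μ => ({⌊x μ / M⌋, ⌊x μ / M⌋ + 1} : Finset ℤ)).card ≤ 2 ^ d := by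
  rw [Fintype.card_piFinset]
  calc ∏ μ, ({⌊x μ / M⌋, ⌊x μ / M⌋ + 1} : Finset ℤ).card ≤ 2 ^ (Finset.univ : Finset (Fin d)).card :=
        Finset.prod_le_pow_card _ _ 2 fun μ _ => Finset.card_le_two
    _ = 2 ^ d := by rw [Finset.card_univ, Fintype.card_fin]

/-- `e⁻¹ ≤ 1/2`. [cite: Balaban1983RegularityDecay, (2.22) p.579] -/
private theorem exp_neg_one_le_half : Real.exp (-1) ≤ 1 / 2 := by
  have h := Real.add_one_le_exp (1 : ℝ)
  rw [Real.exp_neg, inv_eq_one_div]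
  exact one_div_le_one_div_of_le (by norm_num) (by linarith)

/-- **[B4] THEOREM (1.11)–(1.12), VALUE MEMBER, FOR A GENERAL PAIR `Ω ⊂ Ω₀` UNDER `dist(x, Ω^c) ≥ R₀` — the
printed cancellation of the two walk expansions carried through the mixed `L^p` chain on the concrete operators.**
Setting of `B4Ineq112WalkRoute.ineq112_value` (sites `X` of `Ω₀` with `H = covOp c m² a q W T` (1.6) and inverse
`G′ = G_k(Ω₀,A)`; the sub-region `Ω` through the Neumann cut `c^Ω(z,z′) = 1[z ∈ Ω ↔ z′ ∈ Ω]c(z,z′)` with inverse `G`;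
block-compatible cube sets `S_j` (`(7/8)M`-box `⊆ S_j ⊆ M`-box); cube propagators `G_j`, `G_j^Ω`).  INPUTS in the
printed norms, for BOTH cube families: at GOOD labels `‖G_j‖, ‖G_j^Ω‖ ≤ γ`, sup factor bounds `≤ β`, graded factor
bounds `‖·‖_{(i−1)} ≤ β‖·‖_{(i)}` (`1 ≤ i ≤ n₀`; levels `‖·‖_∞` / `η`-weighted `ℓ^{2n₀/i}` / `ℓ²`); at ALL labels the
`L²` factor bound `≤ β`; `3^dβ ≤ e⁻¹`; the `R₀` condition in label form for the cubes seeing `x`.  CONCLUSION: for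
`f` supported in `F × κ` with `‖f‖₂ ≤ V‖f‖_∞` and reals `D ≤ dist_∞(x,F)`, `D₀ ≤ dist_∞(x,Ω^c)`, `D₁ ≤ dist_∞(F,Ω^c)`:
`‖1_x ⊙ ((G_k(Ω,A) − G_k(Ω₀,A))f)‖_∞ ≤ 2^{d+2}e^{17/4}·γ·V·exp(−(D + D₀ + D₁)/(2M))·‖f‖_∞`.  DISCHARGED INSIDE: both
identities `G = G₀ + GR` (`parametrix_identity_hCube`), locality of both families, their agreement at the interior
cubes (`interior_letters_agree`), both remainder decays (`lpv_two_R_pow_mulVec_le`), the separation through a cube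
meeting `Ω^c` (`⌊(D + D₀ + D₁)/(2M) − 13/4⌋`), at most `2^d` starting cubes.
[cite: Balaban1983RegularityDecay, Theorem (1.11)–(1.12) p.573; p.579 after (2.22); (2.18)–(2.21) p.578; Cor. 2.3 p.581] -/
theorem ineq112_value_lp {M : ℝ} (hM : 0 < M) (pos : X → Fin d → ℝ) (c : X → X → ℝ) (m2 a : ℝ)
    (q : Y → X → ℝ) (W : X → X → Matrix κ κ ℝ) (T : Y → X → Matrix κ κ ℝ)
    (hc : ∀ x z', c x z' ≠ 0 → ∀ μ, |pos x μ - pos z' μ| ≤ 1 / 8 * M)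
    (hq : ∀ y x z', q y x ≠ 0 → q y z' ≠ 0 → ∀ μ, |pos x μ - pos z' μ| ≤ 1 / 8 * M)
    (s : Finset (Fin d → ℤ)) (hs : ∀ j x, hCube M j (pos x) ≠ 0 → j ∈ s)
    (S : (Fin d → ℤ) → X → Prop) [∀ j, DecidablePred (S j)]
    (hS : ∀ j z, (∀ μ, |pos z μ - M * j μ| ≤ 7 / 8 * M) → S j z)
    (hS1 : ∀ j z, S j z → ∀ μ, |pos z μ - M * j μ| ≤ M)
    (hSq : ∀ j y z z', q y z ≠ 0 → q y z' ≠ 0 → (S j z ↔ S j z'))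
    (W' : (Fin d → ℤ) → X → X → Matrix κ κ ℝ) (T' : (Fin d → ℤ) → Y → X → Matrix κ κ ℝ)
    (hWW' : ∀ j x z', (∀ μ, |pos x μ - M * j μ| ≤ 3 / 4 * M) → (∀ μ, |pos z' μ - M * j μ| ≤ 3 / 4 * M) →
      W' j x z' = W x z')
    (hTT' : ∀ j y x, q y x ≠ 0 → (∀ μ, |pos x μ - M * j μ| ≤ 3 / 4 * M) → T' j y x = T y x)
    (Ω : X → Prop) [DecidablePred Ω]
    (Gj : (Fin d → ℤ) → Matrix (X × κ) (X × κ) ℝ)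
    (hGj : ∀ j ∈ s, covOp (fun z z' => if (S j z ↔ S j z') then c z z' else 0) m2 a q (W' j) (T' j) * Gj j = 1)
    (GjΩ : (Fin d → ℤ) → Matrix (X × κ) (X × κ) ℝ)
    (hGjΩ : ∀ j ∈ s, covOp (fun z z' => if (S j z ↔ S j z') then (if (Ω z ↔ Ω z') then c z z' else 0) else 0)
      m2 a q (W' j) (T' j) * GjΩ j = 1)
    (G : Matrix (X × κ) (X × κ) ℝ) (hGH : G * covOp (fun z z' => if (Ω z ↔ Ω z') then c z z' else 0) m2 a q W T = 1)
    (G' : Matrix (X × κ) (X × κ) ℝ) (hG'H : G' * covOp c m2 a q W T = 1)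
    -- the interior cubes and the per-cube analytic inputs for both families, in the printed norms
    (good : (Fin d → ℤ) → Prop) {γ β w : ℝ} {n₀ : ℕ} (hn₀ : 0 < n₀) (hw : 0 < w) (hγ0 : 0 ≤ γ) (hβ0 : 0 ≤ β)
    (hγ : ∀ i : ↥s, good i.1 → ‖Gj i.1‖ ≤ γ) (hγΩ : ∀ i : ↥s, good i.1 → ‖GjΩ i.1‖ ≤ γ)
    (h0 : ∀ i : ↥s, good i.1 → ‖opK (fun z z' => if (S i.1 z ↔ S i.1 z') then c z z' else 0) m2 a q (W' i.1) (T' i.1)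
        (fun z => hCube M i.1 (pos z)) * Gj i.1 * mulH (ι := κ) (fun z => hCube M i.1 (pos z))‖ ≤ β)
    (h0Ω : ∀ i : ↥s, good i.1 → ‖opK (fun z z' => if (S i.1 z ↔ S i.1 z') then (if (Ω z ↔ Ω z') then c z z' else 0) else 0)
        m2 a q (W' i.1) (T' i.1) (fun z => hCube M i.1 (pos z)) * GjΩ i.1
        * mulH (ι := κ) (fun z => hCube M i.1 (pos z))‖ ≤ β)
    (hgr : ∀ i : ↥s, good i.1 → ∀ t : ℕ, 1 ≤ t → t ≤ n₀ → ∀ g : X × κ → ℝ,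
      lvl w n₀ (t - 1) ((opK (fun z z' => if (S i.1 z ↔ S i.1 z') then c z z' else 0) m2 a q (W' i.1) (T' i.1)
        (fun z => hCube M i.1 (pos z)) * Gj i.1 * mulH (ι := κ) (fun z => hCube M i.1 (pos z))) *ᵥ g) ≤ β * lvl w n₀ t g)
    (hgrΩ : ∀ i : ↥s, good i.1 → ∀ t : ℕ, 1 ≤ t → t ≤ n₀ → ∀ g : X × κ → ℝ,
      lvl w n₀ (t - 1) ((opK (fun z z' => if (S i.1 z ↔ S i.1 z') then (if (Ω z ↔ Ω z') then c z z' else 0) else 0)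
        m2 a q (W' i.1) (T' i.1) (fun z => hCube M i.1 (pos z)) * GjΩ i.1
        * mulH (ι := κ) (fun z => hCube M i.1 (pos z))) *ᵥ g) ≤ β * lvl w n₀ t g)
    (h2 : ∀ (i : ↥s) (g : X × κ → ℝ), lpv w 2 ((opK (fun z z' => if (S i.1 z ↔ S i.1 z') then c z z' else 0) m2 a q (W' i.1) (T' i.1)
        (fun z => hCube M i.1 (pos z)) * Gj i.1 * mulH (ι := κ) (fun z => hCube M i.1 (pos z))) *ᵥ g) ≤ β * lpv w 2 g)
    (h2Ω : ∀ (i : ↥s) (g : X × κ → ℝ), lpv w 2 ((opK (fun z z' => if (S i.1 z ↔ S i.1 z') then (if (Ω z ↔ Ω z') then c z z' else 0) else 0)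
        m2 a q (W' i.1) (T' i.1) (fun z => hCube M i.1 (pos z)) * GjΩ i.1
        * mulH (ι := κ) (fun z => hCube M i.1 (pos z))) *ᵥ g) ≤ β * lpv w 2 g)
    (h3β : (3 : ℝ) ^ d * β ≤ Real.exp (-1))
    -- the site with its `R₀` condition in label form, the support set, the three separations, the function
    (x : X) (hR₀ : ∀ i ∈ s, hCube M i (pos x) ≠ 0 → ∀ j ∈ s, (∀ μ, |i μ - j μ| ≤ (n₀ : ℤ)) → good j)
    (F : X → Prop) [DecidablePred F] {D D₀ D₁ : ℝ}
    (hD : ∀ x', F x' → ∃ μ, D ≤ |pos x μ - pos x' μ|)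
    (hD₀ : ∀ x₁, ¬ Ω x₁ → ∃ μ, D₀ ≤ |pos x μ - pos x₁ μ|)
    (hD₁ : ∀ x', F x' → ∀ x₁, ¬ Ω x₁ → ∃ μ, D₁ ≤ |pos x₁ μ - pos x' μ|)
    (f : X × κ → ℝ) (hfF : ∀ p : X × κ, ¬ F p.1 → f p = 0) {V : ℝ} (hV : 1 ≤ V) (hfV : lpv w 2 f ≤ V * ‖f‖) :
    ‖mulH (ι := κ) (fun z => if z = x then (1 : ℝ) else 0) *ᵥ ((G - G') *ᵥ f)‖
      ≤ 2 ^ (d + 2) * Real.exp (17 / 4) * γ * V * Real.exp (-((D + D₀ + D₁) / (2 * M))) * ‖f‖ := by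
  classical
  -- the letters of the two expansions
  set h : (Fin d → ℤ) → X → ℝ := fun j z => hCube M j (pos z) with hh
  set cΩ : X → X → ℝ := fun z z' => if (Ω z ↔ Ω z') then c z z' else 0 with hcΩ
  set cut : (Fin d → ℤ) → X → X → ℝ := fun j z z' => if (S j z ↔ S j z') then c z z' else 0 with hcut
  set cutΩ : (Fin d → ℤ) → X → X → ℝ := fun j z z' => if (S j z ↔ S j z') then cΩ z z' else 0 with hcutΩ
  set aJ : (Fin d → ℤ) → Matrix (X × κ) (X × κ) ℝ :=
    fun j => mulH (ι := κ) (h j) * Gj j * mulH (ι := κ) (h j) with haJ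
  set bJ : (Fin d → ℤ) → Matrix (X × κ) (X × κ) ℝ :=
    fun j => opK (cut j) m2 a q (W' j) (T' j) (h j) * Gj j * mulH (ι := κ) (h j) with hbJ
  set aΩ : (Fin d → ℤ) → Matrix (X × κ) (X × κ) ℝ :=
    fun j => mulH (ι := κ) (h j) * GjΩ j * mulH (ι := κ) (h j) with haΩ
  set bΩ : (Fin d → ℤ) → Matrix (X × κ) (X × κ) ℝ :=
    fun j => opK (cutΩ j) m2 a q (W' j) (T' j) (h j) * GjΩ j * mulH (ι := κ) (h j) with hbΩ
  set P : Matrix (X × κ) (X × κ) ℝ := mulH (ι := κ) (fun z => if z = x then (1 : ℝ) else 0) with hPdef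
  have hV0 : 0 ≤ V := zero_le_one.trans hV
  -- locality of the cut weights
  have hcΩloc : ∀ x z', cΩ x z' ≠ 0 → ∀ μ, |pos x μ - pos z' μ| ≤ 1 / 8 * M :=
    fun x z' hne μ => cut_local pos c Ω hc x z' hne μ
  have hM8 : 1 / 8 * M ≤ 3 / 4 * M := by nlinarith
  have hcut_loc : ∀ l z z', cut l z z' ≠ 0 → ∀ μ, |pos z μ - pos z' μ| ≤ 3 / 4 * M :=
    fun l z z' hne μ => (cut_local pos c (S l) hc z z' hne μ).trans hM8
  have hcutΩ_loc : ∀ l z z', cutΩ l z z' ≠ 0 → ∀ μ, |pos z μ - pos z' μ| ≤ 3 / 4 * M :=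
    fun l z z' hne μ => (cut_local pos cΩ (S l) hcΩloc z z' hne μ).trans hM8
  have hq_loc : ∀ y z z', q y z ≠ 0 → q y z' ≠ 0 → ∀ μ, |pos z μ - pos z' μ| ≤ 3 / 4 * M :=
    fun y z z' h1 h2 μ => (hq y z z' h1 h2 μ).trans hM8
  -- sizes of the letters
  have hh0 : ∀ j z, 0 ≤ h j z := fun j z => hCube_nonneg M j (pos z)
  have hh1 : ∀ j z, |h j z| ≤ 1 := fun j z => abs_le.mpr ⟨by linarith [hh0 j z], hCube_le_one M j (pos z)⟩
  have hnH : ∀ j, ‖mulH (ι := κ) (h j)‖ ≤ 1 := fun j => norm_mulH_le _ zero_le_one (hh1 j)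
  have hnP : ‖P‖ ≤ 1 := norm_mulH_le _ zero_le_one fun z => by
    by_cases hz : z = x <;> simp [hz]
  have hnA_gen : ∀ (Gx : Matrix (X × κ) (X × κ) ℝ) (j : Fin d → ℤ), ‖Gx‖ ≤ γ →
      ‖mulH (ι := κ) (h j) * Gx * mulH (ι := κ) (h j)‖ ≤ γ := by
    intro Gx j hGx
    calc ‖mulH (ι := κ) (h j) * Gx * mulH (ι := κ) (h j)‖
        ≤ ‖mulH (ι := κ) (h j) * Gx‖ * ‖mulH (ι := κ) (h j)‖ := norm_mul_le _ _
      _ ≤ (‖mulH (ι := κ) (h j)‖ * ‖Gx‖) * ‖mulH (ι := κ) (h j)‖ :=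
          mul_le_mul_of_nonneg_right (norm_mul_le _ _) (norm_nonneg _)
      _ ≤ (1 * γ) * 1 :=
          mul_le_mul (mul_le_mul (hnH j) hGx (norm_nonneg _) zero_le_one) (hnH j) (norm_nonneg _)
            (by rw [one_mul]; exact hγ0)
      _ = γ := by ring
  -- (2.9)–(2.12) for both propagators: `G′ = G₀ + G′R`, `G = G₀^Ω + GR^Ω`
  have h211 : covOp c m2 a q W T * ∑ j ∈ s, aJ j = 1 - ∑ j ∈ s, bJ j :=
    parametrix_identity_hCube hM pos c m2 a q W T s hs S hS hc hq W' T' hWW' hTT' Gj hGj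
  have h211Ω : covOp cΩ m2 a q W T * ∑ j ∈ s, aΩ j = 1 - ∑ j ∈ s, bΩ j :=
    parametrix_identity_hCube hM pos cΩ m2 a q W T s hs S hS hcΩloc hq W' T' hWW' hTT' GjΩ hGjΩ
  have hGeq : G' * (1 - ∑ j ∈ s, bJ j) = ∑ j ∈ s, aJ j := G_mul_one_sub_eq hG'H h211
  have hGeqΩ : G * (1 - ∑ j ∈ s, bΩ j) = ∑ j ∈ s, aΩ j := G_mul_one_sub_eq hGH h211Ω
  have hG'id : G' = ∑ j ∈ s, aJ j + G' * ∑ j ∈ s, bJ j := by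
    rw [← hGeq, mul_sub, mul_one]
    abel
  have hGid : G = ∑ j ∈ s, aΩ j + G * ∑ j ∈ s, bΩ j := by
    rw [← hGeqΩ, mul_sub, mul_one]
    abel
  -- interior cubes give identical letters: the two families agree off the cubes meeting `Ω^c`
  set TΩ : Finset ↥s := Finset.univ.filter fun j : ↥s => ∃ z, S j.1 z ∧ ¬ Ω z with hTΩ
  have hagree : ∀ j : ↥s, j ∉ TΩ → aΩ j.1 = aJ j.1 ∧ bΩ j.1 = bJ j.1 := by
    intro j hj
    have hSΩ : ∀ z, S j.1 z → Ω z := by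
      intro z hz
      by_contra hΩz
      exact hj (Finset.mem_filter.mpr ⟨Finset.mem_univ _, z, hz, hΩz⟩)
    have hsupp : ∀ z, h j.1 z ≠ 0 → S j.1 z := fun z hz =>
      hS j.1 z fun μ => (hCube_ne_zero_imp hM hz μ).le.trans (by nlinarith)
    have hag := interior_letters_agree c m2 a q (W' j.1) (T' j.1) (S j.1) Ω hSΩ (hSq j.1) (h j.1) hsupp
      (hGj j.1 j.2) (hGjΩ j.1 j.2)
    exact ⟨hag.1.symm, hag.2.symm⟩
  -- locality of the letters (non-neighbouring cubes)
  have hloc_gen : ∀ (cx : (Fin d → ℤ) → X → X → ℝ),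
      (∀ l z z', cx l z z' ≠ 0 → ∀ μ, |pos z μ - pos z' μ| ≤ 3 / 4 * M) →
      ∀ i l : ↥s, ¬ cubeAdj (fun i : ↥s => i.1) i l →
        mulH (ι := κ) (h i.1) * opK (cx l.1) m2 a q (W' l.1) (T' l.1) (h l.1) = 0 :=
    fun cx hcx i l hil => mulH_hCube_mul_opK_eq_zero hM pos (cx l.1) m2 a q (W' l.1) (T' l.1) (hcx l.1) hq_loc hil
  have hab_gen : ∀ (cx : (Fin d → ℤ) → X → X → ℝ) (Gx : (Fin d → ℤ) → Matrix (X × κ) (X × κ) ℝ),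
      (∀ l z z', cx l z z' ≠ 0 → ∀ μ, |pos z μ - pos z' μ| ≤ 3 / 4 * M) →
      ∀ i l : ↥s, ¬ cubeAdj (fun i : ↥s => i.1) i l →
        (mulH (ι := κ) (h i.1) * Gx i.1 * mulH (ι := κ) (h i.1))
          * (opK (cx l.1) m2 a q (W' l.1) (T' l.1) (h l.1) * Gx l.1 * mulH (ι := κ) (h l.1)) = 0 := by
    intro cx Gx hcx i l hil
    rw [show mulH (ι := κ) (h i.1) * Gx i.1 * mulH (ι := κ) (h i.1)
          * (opK (cx l.1) m2 a q (W' l.1) (T' l.1) (h l.1) * Gx l.1 * mulH (ι := κ) (h l.1))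
        = mulH (ι := κ) (h i.1) * Gx i.1
          * (mulH (ι := κ) (h i.1) * opK (cx l.1) m2 a q (W' l.1) (T' l.1) (h l.1))
          * Gx l.1 * mulH (ι := κ) (h l.1) by simp only [Matrix.mul_assoc],
      hloc_gen cx hcx i l hil, Matrix.mul_zero, Matrix.zero_mul, Matrix.zero_mul]
  have hbb_gen : ∀ (cx : (Fin d → ℤ) → X → X → ℝ) (Gx : (Fin d → ℤ) → Matrix (X × κ) (X × κ) ℝ),
      (∀ l z z', cx l z z' ≠ 0 → ∀ μ, |pos z μ - pos z' μ| ≤ 3 / 4 * M) →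
      ∀ i l : ↥s, ¬ cubeAdj (fun i : ↥s => i.1) i l →
        (opK (cx i.1) m2 a q (W' i.1) (T' i.1) (h i.1) * Gx i.1 * mulH (ι := κ) (h i.1))
          * (opK (cx l.1) m2 a q (W' l.1) (T' l.1) (h l.1) * Gx l.1 * mulH (ι := κ) (h l.1)) = 0 := by
    intro cx Gx hcx i l hil
    rw [show opK (cx i.1) m2 a q (W' i.1) (T' i.1) (h i.1) * Gx i.1 * mulH (ι := κ) (h i.1)
          * (opK (cx l.1) m2 a q (W' l.1) (T' l.1) (h l.1) * Gx l.1 * mulH (ι := κ) (h l.1))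
        = opK (cx i.1) m2 a q (W' i.1) (T' i.1) (h i.1) * Gx i.1
          * (mulH (ι := κ) (h i.1) * opK (cx l.1) m2 a q (W' l.1) (T' l.1) (h l.1))
          * Gx l.1 * mulH (ι := κ) (h l.1) by simp only [Matrix.mul_assoc],
      hloc_gen cx hcx i l hil, Matrix.mul_zero, Matrix.zero_mul, Matrix.zero_mul]
  -- the starting and the final cubes; the cut-offs on vectors
  set S₀ : Finset ↥s := Finset.univ.filter fun i : ↥s => h i.1 x ≠ 0 with hS₀
  set S₁ : Finset ↥s := Finset.univ.filter fun i : ↥s => ∃ x', F x' ∧ h i.1 x' ≠ 0 with hS₁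
  have hP_gen : ∀ (Gx : Matrix (X × κ) (X × κ) ℝ) (i : ↥s), i ∉ S₀ →
      P * (mulH (ι := κ) (h i.1) * Gx * mulH (ι := κ) (h i.1)) = 0 := by
    intro Gx i hi
    have hix : h i.1 x = 0 := by
      by_contra hne
      exact hi (Finset.mem_filter.mpr ⟨Finset.mem_univ _, hne⟩)
    have hzero : P * mulH (ι := κ) (h i.1) = 0 := by
      rw [hPdef, mulH_mul_mulH]
      refine mulH_eq_zero_of fun z => ?_
      by_cases hz : z = x
      · rw [hz, hix, mul_zero]
      · rw [if_neg hz, zero_mul]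
    rw [← Matrix.mul_assoc, ← Matrix.mul_assoc, hzero, Matrix.zero_mul, Matrix.zero_mul]
  have hF0 : ∀ i : ↥s, i ∉ S₁ → mulH (ι := κ) (h i.1) *ᵥ f = 0 := by
    intro i hi
    funext p
    rw [mulH_mulVec_apply, Pi.zero_apply]
    by_cases hz : F p.1
    · have hiz : h i.1 p.1 = 0 := by
        by_contra hne
        exact hi (Finset.mem_filter.mpr ⟨Finset.mem_univ _, p.1, hz, hne⟩)
      rw [hiz, zero_mul]
    · rw [hfF p hz, mul_zero]
  have hS₁_gen : ∀ (Kx Gx : Matrix (X × κ) (X × κ) ℝ) (i : ↥s), i ∉ S₁ →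
      (Kx * Gx * mulH (ι := κ) (h i.1)) • f = 0 := by
    intro Kx Gx i hi
    rw [Matrix.smul_eq_mulVec, ← Matrix.mulVec_mulVec, hF0 i hi, Matrix.mulVec_zero]
  -- the probe functional `Φ(g) = ‖1_x ⊙ g‖_∞` on the two first-letter families
  have hS₀_gen : ∀ (Gx : (Fin d → ℤ) → Matrix (X × κ) (X × κ) ℝ) (i : ↥s), i ∉ S₀ → ∀ g : X × κ → ℝ,
      ‖P *ᵥ ((mulH (ι := κ) (h i.1) * Gx i.1 * mulH (ι := κ) (h i.1)) • g)‖ ≤ 0 := by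
    intro Gx i hi g
    rw [Matrix.smul_eq_mulVec, Matrix.mulVec_mulVec, hP_gen (Gx i.1) i hi, Matrix.zero_mulVec, norm_zero]
  have hgoodS₀ : ∀ i ∈ S₀, good i.1 := fun i hi =>
    hR₀ i.1 i.2 (Finset.mem_filter.mp hi).2 i.1 i.2 fun μ => by simp
  have ha_gen : ∀ (Gx : (Fin d → ℤ) → Matrix (X × κ) (X × κ) ℝ), (∀ i : ↥s, good i.1 → ‖Gx i.1‖ ≤ γ) →
      ∀ i ∈ S₀, ∀ g : X × κ → ℝ,
        ‖P *ᵥ ((mulH (ι := κ) (h i.1) * Gx i.1 * mulH (ι := κ) (h i.1)) • g)‖ ≤ γ * lvl w n₀ 0 g := by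
    intro Gx hGx i hi g
    rw [Matrix.smul_eq_mulVec, Matrix.mulVec_mulVec, lvl_zero]
    calc ‖(P * (mulH (ι := κ) (h i.1) * Gx i.1 * mulH (ι := κ) (h i.1))) *ᵥ g‖
        ≤ ‖P * (mulH (ι := κ) (h i.1) * Gx i.1 * mulH (ι := κ) (h i.1))‖ * ‖g‖ := Matrix.linfty_opNorm_mulVec _ _
      _ ≤ γ * ‖g‖ := by
          refine mul_le_mul_of_nonneg_right ((norm_mul_le _ _).trans ?_) (norm_nonneg _)
          calc ‖P‖ * ‖mulH (ι := κ) (h i.1) * Gx i.1 * mulH (ι := κ) (h i.1)‖ ≤ 1 * γ :=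
                mul_le_mul hnP (hnA_gen (Gx i.1) i.1 (hGx i (hgoodS₀ i hi))) (norm_nonneg _) zero_le_one
            _ = γ := one_mul γ
  -- the per-cube inputs in the abstract chain's format
  have hgr_gen : ∀ (bx : (Fin d → ℤ) → Matrix (X × κ) (X × κ) ℝ),
      (∀ i : ↥s, good i.1 → ∀ t : ℕ, 1 ≤ t → t ≤ n₀ → ∀ g : X × κ → ℝ,
        lvl w n₀ (t - 1) (bx i.1 *ᵥ g) ≤ β * lvl w n₀ t g) →
      ∀ j : ↥s, good j.1 → ∀ t : ℕ, 1 ≤ t → t ≤ n₀ → ∀ g : X × κ → ℝ,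
        lvl w n₀ (t - 1) (bx j.1 • g) ≤ β * lvl w n₀ t g := fun bx hbx j hj t ht1 ht2 g => by
    rw [Matrix.smul_eq_mulVec]
    exact hbx j hj t ht1 ht2 g
  have h2_gen : ∀ (bx : (Fin d → ℤ) → Matrix (X × κ) (X × κ) ℝ),
      (∀ (i : ↥s) (g : X × κ → ℝ), lpv w 2 (bx i.1 *ᵥ g) ≤ β * lpv w 2 g) →
      ∀ (j : ↥s) (g : X × κ → ℝ), lvl w n₀ n₀ (bx j.1 • g) ≤ β * lvl w n₀ n₀ g := fun bx hbx j g => by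
    rw [Matrix.smul_eq_mulVec, lvl_top w hn₀, lvl_top w hn₀]
    exact hbx j g
  have h0_gen : ∀ (bx : (Fin d → ℤ) → Matrix (X × κ) (X × κ) ℝ), (∀ i : ↥s, good i.1 → ‖bx i.1‖ ≤ β) →
      ∀ j : ↥s, good j.1 → ∀ g : X × κ → ℝ, lvl w n₀ 0 (bx j.1 • g) ≤ β * lvl w n₀ 0 g := fun bx hbx j hj g => by
    rw [Matrix.smul_eq_mulVec, lvl_zero, lvl_zero]
    exact (Matrix.linfty_opNorm_mulVec _ _).trans (mul_le_mul_of_nonneg_right (hbx j hj) (norm_nonneg _))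
  have h2inf' : lvl w n₀ n₀ f ≤ V * lvl w n₀ 0 f := by
    rw [lvl_top w hn₀, lvl_zero]
    exact hfV
  have hR₀' : ∀ i ∈ S₀, ∀ j : ↥s, (∀ μ, |i.1 μ - j.1 μ| ≤ (n₀ : ℤ)) → good j.1 :=
    fun i hi j hij => hR₀ i.1 i.2 (Finset.mem_filter.mp hi).2 j.1 j.2 hij
  -- the separation THROUGH a cube meeting `Ω^c`: `N = ⌊(D + D₀ + D₁)/(2M) − 13/4⌋ ≥ r − 2`, `r = (D + D₀ + D₁)/(2M) − 9/4`
  set N : ℕ := ⌊(D + D₀ + D₁) / (2 * M) - 13 / 4⌋₊ with hNdef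
  have hN : ((D + D₀ + D₁) / (2 * M) - 9 / 4) - 2 ≤ (N : ℝ) := by
    have := Nat.sub_one_lt_floor ((D + D₀ + D₁) / (2 * M) - 13 / 4)
    linarith
  have hsep : ∀ i ∈ S₀, ∀ t ∈ TΩ, ∀ l ∈ S₁, ∃ μ ν, (N : ℤ) ≤ |i.1 μ - t.1 μ| + |t.1 ν - l.1 ν| := by
    intro i hi t ht l hl
    obtain ⟨-, hix⟩ := Finset.mem_filter.mp hi
    obtain ⟨-, x₁, hSx₁, hΩx₁⟩ := Finset.mem_filter.mp ht
    obtain ⟨-, x', hFx', hlx'⟩ := Finset.mem_filter.mp hl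
    by_cases hSig : 0 ≤ (D + D₀ + D₁) / (2 * M) - 13 / 4
    · have hNle : (N : ℝ) ≤ (D + D₀ + D₁) / (2 * M) - 13 / 4 := Nat.floor_le hSig
      have hNM : ((N : ℝ) + 13 / 4) * M ≤ (D + D₀ + D₁) / 2 := by
        have : (N : ℝ) + 13 / 4 ≤ (D + D₀ + D₁) / 2 / M := by rw [div_div]; linarith
        rwa [le_div_iff₀ hM] at this
      have hi5 : ∀ μ, |pos x μ - M * i.1 μ| < 5 / 8 * M := hCube_ne_zero_imp hM hix
      have ht1 : ∀ μ, |pos x₁ μ - M * t.1 μ| ≤ M := hS1 t.1 x₁ hSx₁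
      have hl5 : ∀ μ, |pos x' μ - M * l.1 μ| < 5 / 8 * M := hCube_ne_zero_imp hM hlx'
      have hit : ∀ μ, |pos x μ - pos x₁ μ| - 13 / 8 * M < M * |((i.1 μ : ℤ) : ℝ) - t.1 μ| := by
        intro μ
        have htri : |pos x μ - pos x₁ μ|
            ≤ |pos x μ - M * i.1 μ| + |M * i.1 μ - M * t.1 μ| + |pos x₁ μ - M * t.1 μ| := by
          calc |pos x μ - pos x₁ μ|
              = |(pos x μ - M * i.1 μ) + (M * i.1 μ - M * t.1 μ) + (M * t.1 μ - pos x₁ μ)| := by ring_nf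
            _ ≤ |pos x μ - M * i.1 μ| + |M * i.1 μ - M * t.1 μ| + |M * t.1 μ - pos x₁ μ| := abs_add_three _ _ _
            _ = _ := by rw [abs_sub_comm (M * t.1 μ) (pos x₁ μ)]
        rw [← mul_sub, abs_mul, abs_of_pos hM] at htri
        linarith [hi5 μ, ht1 μ]
      have htl : ∀ ν, |pos x₁ ν - pos x' ν| - 13 / 8 * M < M * |((t.1 ν : ℤ) : ℝ) - l.1 ν| := by
        intro ν
        have htri : |pos x₁ ν - pos x' ν|
            ≤ |pos x₁ ν - M * t.1 ν| + |M * t.1 ν - M * l.1 ν| + |pos x' ν - M * l.1 ν| := by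
          calc |pos x₁ ν - pos x' ν|
              = |(pos x₁ ν - M * t.1 ν) + (M * t.1 ν - M * l.1 ν) + (M * l.1 ν - pos x' ν)| := by ring_nf
            _ ≤ |pos x₁ ν - M * t.1 ν| + |M * t.1 ν - M * l.1 ν| + |M * l.1 ν - pos x' ν| := abs_add_three _ _ _
            _ = _ := by rw [abs_sub_comm (M * l.1 ν) (pos x' ν)]
        rw [← mul_sub, abs_mul, abs_of_pos hM] at htri
        linarith [ht1 ν, hl5 ν]
      have key : ∃ μ ν, (D + D₀ + D₁) / 2 ≤ |pos x μ - pos x₁ μ| + |pos x₁ ν - pos x' ν| := by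
        by_cases hcase : D ≤ D₀ + D₁
        · obtain ⟨μ, hμ⟩ := hD₀ x₁ hΩx₁
          obtain ⟨ν, hν⟩ := hD₁ x' hFx' x₁ hΩx₁
          exact ⟨μ, ν, by linarith⟩
        · obtain ⟨μ, hμ⟩ := hD x' hFx'
          refine ⟨μ, μ, ?_⟩
          have htri : |pos x μ - pos x' μ| ≤ |pos x μ - pos x₁ μ| + |pos x₁ μ - pos x' μ| := by
            calc |pos x μ - pos x' μ| = |(pos x μ - pos x₁ μ) + (pos x₁ μ - pos x' μ)| := by ring_nf
              _ ≤ _ := abs_add_le _ _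
          linarith
      obtain ⟨μ, ν, hμν⟩ := key
      refine ⟨μ, ν, ?_⟩
      have hsum' : (N : ℝ) * M < M * |((i.1 μ : ℤ) : ℝ) - t.1 μ| + M * |((t.1 ν : ℤ) : ℝ) - l.1 ν| := by
        linarith [hit μ, htl ν]
      rw [← mul_add] at hsum'
      have h5 : (N : ℝ) < |((i.1 μ : ℤ) : ℝ) - t.1 μ| + |((t.1 ν : ℤ) : ℝ) - l.1 ν| := by
        by_contra hle
        rw [not_lt] at hle
        have := mul_le_mul_of_nonneg_left hle hM.le
        linarith
      have h6 : ((N : ℤ) : ℝ) < ((|i.1 μ - t.1 μ| + |t.1 ν - l.1 ν| : ℤ) : ℝ) := by push_cast; exact h5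
      exact (Int.cast_lt.mp h6).le
    · have hN0 : N = 0 := Nat.floor_eq_zero.mpr (by linarith)
      obtain ⟨μ, -⟩ := hD x' hFx'
      refine ⟨μ, μ, ?_⟩
      rw [hN0]
      positivity
  have hcardS₀ : S₀.card ≤ 2 ^ d := by
    have hsub : S₀.map (Function.Embedding.subtype (· ∈ s))
        ⊆ Fintype.piFinset fun μ => ({⌊pos x μ / M⌋, ⌊pos x μ / M⌋ + 1} : Finset ℤ) := by
      intro j hj
      obtain ⟨i, hi, rfl⟩ := Finset.mem_map.mp hj
      obtain ⟨-, hix⟩ := Finset.mem_filter.mp hi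
      exact mem_box_of_hCube_ne_zero hix
    calc S₀.card = (S₀.map (Function.Embedding.subtype (· ∈ s))).card := (Finset.card_map _).symm
      _ ≤ _ := Finset.card_le_card hsub
      _ ≤ 2 ^ d := card_labelBox_le M (pos x)
  -- BOTH REMAINDERS DECAY: `‖1_x ⊙ (G₁R₁^m f)‖_∞ ≤ ‖G₁‖(2^dβ)^m‖f‖₂/√w`, `2^dβ ≤ 1/2`
  have hθ : (2 : ℝ) ^ d * β ≤ 1 / 2 :=
    ((mul_le_mul_of_nonneg_right (pow_le_pow_left₀ (by norm_num) (by norm_num) d) hβ0).trans h3β).trans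
      exp_neg_one_le_half
  have hrem_gen : ∀ (G₁ Rx : Matrix (X × κ) (X × κ) ℝ),
      (∀ m : ℕ, lpv w 2 ((Rx ^ m) *ᵥ f) ≤ ((2 : ℝ) ^ d * β) ^ m * lpv w 2 f) →
      ∀ m : ℕ, ‖P *ᵥ ((G₁ * Rx ^ m) • f)‖ ≤ (1 / 2 : ℝ) ^ m * (‖G₁‖ * (lpv w 2 f / Real.sqrt w)) := by
    intro G₁ Rx hRx m
    rw [Matrix.smul_eq_mulVec, ← Matrix.mulVec_mulVec, Matrix.mulVec_mulVec]
    have hPG : ‖P * G₁‖ ≤ ‖G₁‖ :=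
      (norm_mul_le _ _).trans ((mul_le_mul_of_nonneg_right hnP (norm_nonneg _)).trans (le_of_eq (one_mul _)))
    have hC0 : 0 ≤ ‖G₁‖ * (lpv w 2 f / Real.sqrt w) :=
      mul_nonneg (norm_nonneg _) (div_nonneg (lpv_nonneg hw.le 2 f) (Real.sqrt_nonneg _))
    calc ‖(P * G₁) *ᵥ ((Rx ^ m) *ᵥ f)‖ ≤ ‖P * G₁‖ * ‖(Rx ^ m) *ᵥ f‖ := Matrix.linfty_opNorm_mulVec _ _
      _ ≤ ‖G₁‖ * (lpv w 2 ((Rx ^ m) *ᵥ f) / Real.sqrt w) :=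
          mul_le_mul hPG (norm_le_lpv_two hw _) (norm_nonneg _) (norm_nonneg _)
      _ ≤ ‖G₁‖ * ((((2 : ℝ) ^ d * β) ^ m * lpv w 2 f) / Real.sqrt w) := by
          gcongr
          exact hRx m
      _ = ((2 : ℝ) ^ d * β) ^ m * (‖G₁‖ * (lpv w 2 f / Real.sqrt w)) := by ring
      _ ≤ (1 / 2 : ℝ) ^ m * (‖G₁‖ * (lpv w 2 f / Real.sqrt w)) :=
          mul_le_mul_of_nonneg_right (pow_le_pow_left₀ (by positivity) hθ m) hC0
  have hrem : ∀ ε : ℝ, 0 < ε → ∃ m : ℕ, ‖P *ᵥ ((G * (∑ j ∈ s, bΩ j) ^ m) • f)‖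
      + ‖P *ᵥ ((G' * (∑ j ∈ s, bJ j) ^ m) • f)‖ ≤ ε := by
    intro ε hε
    set C : ℝ := ‖G‖ * (lpv w 2 f / Real.sqrt w) + ‖G'‖ * (lpv w 2 f / Real.sqrt w) with hC
    have hq0 : 0 ≤ lpv w 2 f / Real.sqrt w := div_nonneg (lpv_nonneg hw.le 2 f) (Real.sqrt_nonneg _)
    have hC0 : 0 ≤ C := add_nonneg (mul_nonneg (norm_nonneg _) hq0) (mul_nonneg (norm_nonneg _) hq0)
    obtain ⟨m, hm⟩ := exists_pow_lt_of_lt_one (show 0 < ε / (C + 1) by positivity) (show (1 / 2 : ℝ) < 1 by norm_num)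
    refine ⟨m, ?_⟩
    rw [lt_div_iff₀ (by positivity)] at hm
    have h1 := hrem_gen G (∑ j ∈ s, bΩ j)
      (fun m => lpv_two_R_pow_mulVec_le hM pos cΩ m2 a q hcΩloc hq s S W' T' GjΩ hβ0 hw h2Ω f m) m
    have h2r := hrem_gen G' (∑ j ∈ s, bJ j)
      (fun m => lpv_two_R_pow_mulVec_le hM pos c m2 a q hc hq s S W' T' Gj hβ0 hw h2 f m) m
    calc _ ≤ (1 / 2 : ℝ) ^ m * (‖G‖ * (lpv w 2 f / Real.sqrt w))
          + (1 / 2 : ℝ) ^ m * (‖G'‖ * (lpv w 2 f / Real.sqrt w)) := add_le_add h1 h2r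
      _ = (1 / 2 : ℝ) ^ m * C := by rw [hC]; ring
      _ ≤ (1 / 2 : ℝ) ^ m * (C + 1) := by gcongr; linarith
      _ ≤ ε := hm.le
  -- the abstract cancellation bound through the chain
  have hmain := lattice_lp_walk_delta_bound_rem (R := Matrix (X × κ) (X × κ) ℝ) (E := X × κ → ℝ)
    (fun i : ↥s => i.1) Subtype.val_injective
    (a := fun i : ↥s => aΩ i.1) (b := fun i : ↥s => bΩ i.1) (a' := fun i : ↥s => aJ i.1) (b' := fun i : ↥s => bJ i.1)
    (G := G) (G' := G') (f := f) (Φ := fun g => ‖P *ᵥ g‖) (nrm := lvl w n₀) (good := fun i : ↥s => good i.1)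
    (S₀ := S₀) (S₁ := S₁) (T := TΩ) (c₁ := γ) (β := β) (r := (D + D₀ + D₁) / (2 * M) - 9 / 4) (N := N)
    (n₀ := n₀) (V := V)
    (by rw [Finset.sum_coe_sort s aΩ]) (by rw [Finset.sum_coe_sort s bΩ])
    (by rw [Finset.sum_coe_sort s aJ]) (by rw [Finset.sum_coe_sort s bJ]) hGid hG'id hrem
    (hab_gen cutΩ GjΩ hcutΩ_loc) (hbb_gen cutΩ GjΩ hcutΩ_loc) (hab_gen cut Gj hcut_loc) (hbb_gen cut Gj hcut_loc)
    (fun i hi => (hagree i hi).1) (fun i hi => (hagree i hi).2)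
    (by simp) (fun u v => by simpa [Matrix.mulVec_add] using norm_add_le (P *ᵥ u) (P *ᵥ v))
    (fun u v => by simpa [Matrix.mulVec_sub] using norm_sub_le (P *ᵥ u) (P *ᵥ v))
    (hS₀_gen GjΩ) (hS₀_gen Gj)
    (fun i hi => hS₁_gen _ _ i hi) (fun i hi => hS₁_gen _ _ i hi)
    (fun i hi => hS₁_gen _ _ i hi) (fun i hi => hS₁_gen _ _ i hi)
    hγ0 (ha_gen GjΩ hγΩ) (ha_gen Gj hγ) hβ0
    (hgr_gen bΩ hgrΩ) (h2_gen bΩ h2Ω) (h0_gen bΩ h0Ω) (hgr_gen bJ hgr) (h2_gen bJ h2) (h0_gen bJ h0)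
    hV h2inf' (by rw [lvl_zero]; exact norm_nonneg _) hR₀' h3β hsep hN
  simp only [Matrix.smul_eq_mulVec, lvl_zero] at hmain
  -- the exponent bookkeeping
  have hexp : Real.exp 2 * Real.exp (-((D + D₀ + D₁) / (2 * M) - 9 / 4))
      = Real.exp (17 / 4) * Real.exp (-((D + D₀ + D₁) / (2 * M))) := by
    rw [← Real.exp_add, ← Real.exp_add]
    congr 1
    ring
  calc ‖P *ᵥ ((G - G') *ᵥ f)‖
      ≤ 4 * S₀.card * γ * V * Real.exp 2 * Real.exp (-((D + D₀ + D₁) / (2 * M) - 9 / 4)) * ‖f‖ := hmain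
    _ ≤ 4 * (2 : ℝ) ^ d * γ * V * Real.exp 2 * Real.exp (-((D + D₀ + D₁) / (2 * M) - 9 / 4)) * ‖f‖ := by
        gcongr
        exact_mod_cast hcardS₀
    _ = 4 * (2 : ℝ) ^ d * γ * V * (Real.exp 2 * Real.exp (-((D + D₀ + D₁) / (2 * M) - 9 / 4))) * ‖f‖ := by ring
    _ = 2 ^ (d + 2) * Real.exp (17 / 4) * γ * V * Real.exp (-((D + D₀ + D₁) / (2 * M))) * ‖f‖ := by
        rw [hexp]; ring

/-- **(1.11)–(1.12) AS PRINTED, value member, general `Ω ⊂ Ω₀` under the `R₀` condition**: for `f` supported in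
`F × κ` with `‖f‖₂ ≤ V‖f‖_∞` and every colour `k`,
`|(δG_k(Ω,Ω₀,A)f)(x)_k| ≤ 2^{d+2}e^{17/4}γV·exp(−(2M)⁻¹(dist(x,supp f) + dist(x,Ω^c) + dist(supp f,Ω^c)))·‖f‖_∞`.
[cite: Balaban1983RegularityDecay, Theorem (1.11)–(1.12) p.573; p.579] -/
theorem ineq112_value_lp_apply {M : ℝ} (hM : 0 < M) (pos : X → Fin d → ℝ) (c : X → X → ℝ) (m2 a : ℝ)
    (q : Y → X → ℝ) (W : X → X → Matrix κ κ ℝ) (T : Y → X → Matrix κ κ ℝ)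
    (hc : ∀ x z', c x z' ≠ 0 → ∀ μ, |pos x μ - pos z' μ| ≤ 1 / 8 * M)
    (hq : ∀ y x z', q y x ≠ 0 → q y z' ≠ 0 → ∀ μ, |pos x μ - pos z' μ| ≤ 1 / 8 * M)
    (s : Finset (Fin d → ℤ)) (hs : ∀ j x, hCube M j (pos x) ≠ 0 → j ∈ s)
    (S : (Fin d → ℤ) → X → Prop) [∀ j, DecidablePred (S j)]
    (hS : ∀ j z, (∀ μ, |pos z μ - M * j μ| ≤ 7 / 8 * M) → S j z)
    (hS1 : ∀ j z, S j z → ∀ μ, |pos z μ - M * j μ| ≤ M)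
    (hSq : ∀ j y z z', q y z ≠ 0 → q y z' ≠ 0 → (S j z ↔ S j z'))
    (W' : (Fin d → ℤ) → X → X → Matrix κ κ ℝ) (T' : (Fin d → ℤ) → Y → X → Matrix κ κ ℝ)
    (hWW' : ∀ j x z', (∀ μ, |pos x μ - M * j μ| ≤ 3 / 4 * M) → (∀ μ, |pos z' μ - M * j μ| ≤ 3 / 4 * M) →
      W' j x z' = W x z')
    (hTT' : ∀ j y x, q y x ≠ 0 → (∀ μ, |pos x μ - M * j μ| ≤ 3 / 4 * M) → T' j y x = T y x)
    (Ω : X → Prop) [DecidablePred Ω]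
    (Gj : (Fin d → ℤ) → Matrix (X × κ) (X × κ) ℝ)
    (hGj : ∀ j ∈ s, covOp (fun z z' => if (S j z ↔ S j z') then c z z' else 0) m2 a q (W' j) (T' j) * Gj j = 1)
    (GjΩ : (Fin d → ℤ) → Matrix (X × κ) (X × κ) ℝ)
    (hGjΩ : ∀ j ∈ s, covOp (fun z z' => if (S j z ↔ S j z') then (if (Ω z ↔ Ω z') then c z z' else 0) else 0)
      m2 a q (W' j) (T' j) * GjΩ j = 1)
    (G : Matrix (X × κ) (X × κ) ℝ) (hGH : G * covOp (fun z z' => if (Ω z ↔ Ω z') then c z z' else 0) m2 a q W T = 1)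
    (G' : Matrix (X × κ) (X × κ) ℝ) (hG'H : G' * covOp c m2 a q W T = 1)
    -- the interior cubes and the per-cube analytic inputs for both families, in the printed norms
    (good : (Fin d → ℤ) → Prop) {γ β w : ℝ} {n₀ : ℕ} (hn₀ : 0 < n₀) (hw : 0 < w) (hγ0 : 0 ≤ γ) (hβ0 : 0 ≤ β)
    (hγ : ∀ i : ↥s, good i.1 → ‖Gj i.1‖ ≤ γ) (hγΩ : ∀ i : ↥s, good i.1 → ‖GjΩ i.1‖ ≤ γ)
    (h0 : ∀ i : ↥s, good i.1 → ‖opK (fun z z' => if (S i.1 z ↔ S i.1 z') then c z z' else 0) m2 a q (W' i.1) (T' i.1)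
        (fun z => hCube M i.1 (pos z)) * Gj i.1 * mulH (ι := κ) (fun z => hCube M i.1 (pos z))‖ ≤ β)
    (h0Ω : ∀ i : ↥s, good i.1 → ‖opK (fun z z' => if (S i.1 z ↔ S i.1 z') then (if (Ω z ↔ Ω z') then c z z' else 0) else 0)
        m2 a q (W' i.1) (T' i.1) (fun z => hCube M i.1 (pos z)) * GjΩ i.1
        * mulH (ι := κ) (fun z => hCube M i.1 (pos z))‖ ≤ β)
    (hgr : ∀ i : ↥s, good i.1 → ∀ t : ℕ, 1 ≤ t → t ≤ n₀ → ∀ g : X × κ → ℝ,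
      lvl w n₀ (t - 1) ((opK (fun z z' => if (S i.1 z ↔ S i.1 z') then c z z' else 0) m2 a q (W' i.1) (T' i.1)
        (fun z => hCube M i.1 (pos z)) * Gj i.1 * mulH (ι := κ) (fun z => hCube M i.1 (pos z))) *ᵥ g) ≤ β * lvl w n₀ t g)
    (hgrΩ : ∀ i : ↥s, good i.1 → ∀ t : ℕ, 1 ≤ t → t ≤ n₀ → ∀ g : X × κ → ℝ,
      lvl w n₀ (t - 1) ((opK (fun z z' => if (S i.1 z ↔ S i.1 z') then (if (Ω z ↔ Ω z') then c z z' else 0) else 0)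
        m2 a q (W' i.1) (T' i.1) (fun z => hCube M i.1 (pos z)) * GjΩ i.1
        * mulH (ι := κ) (fun z => hCube M i.1 (pos z))) *ᵥ g) ≤ β * lvl w n₀ t g)
    (h2 : ∀ (i : ↥s) (g : X × κ → ℝ), lpv w 2 ((opK (fun z z' => if (S i.1 z ↔ S i.1 z') then c z z' else 0) m2 a q (W' i.1) (T' i.1)
        (fun z => hCube M i.1 (pos z)) * Gj i.1 * mulH (ι := κ) (fun z => hCube M i.1 (pos z))) *ᵥ g) ≤ β * lpv w 2 g)
    (h2Ω : ∀ (i : ↥s) (g : X × κ → ℝ), lpv w 2 ((opK (fun z z' => if (S i.1 z ↔ S i.1 z') then (if (Ω z ↔ Ω z') then c z z' else 0) else 0)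
        m2 a q (W' i.1) (T' i.1) (fun z => hCube M i.1 (pos z)) * GjΩ i.1
        * mulH (ι := κ) (fun z => hCube M i.1 (pos z))) *ᵥ g) ≤ β * lpv w 2 g)
    (h3β : (3 : ℝ) ^ d * β ≤ Real.exp (-1))
    -- the site with its `R₀` condition in label form, the support set, the three separations, the function
    (x : X) (hR₀ : ∀ i ∈ s, hCube M i (pos x) ≠ 0 → ∀ j ∈ s, (∀ μ, |i μ - j μ| ≤ (n₀ : ℤ)) → good j)
    (F : X → Prop) [DecidablePred F] {D D₀ D₁ : ℝ}
    (hD : ∀ x', F x' → ∃ μ, D ≤ |pos x μ - pos x' μ|)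
    (hD₀ : ∀ x₁, ¬ Ω x₁ → ∃ μ, D₀ ≤ |pos x μ - pos x₁ μ|)
    (hD₁ : ∀ x', F x' → ∀ x₁, ¬ Ω x₁ → ∃ μ, D₁ ≤ |pos x₁ μ - pos x' μ|)
    (f : X × κ → ℝ) (hfF : ∀ p : X × κ, ¬ F p.1 → f p = 0) {V : ℝ} (hV : 1 ≤ V) (hfV : lpv w 2 f ≤ V * ‖f‖) (k : κ) :
    |((G - G') *ᵥ f) (x, k)|
      ≤ 2 ^ (d + 2) * Real.exp (17 / 4) * γ * V * Real.exp (-((D + D₀ + D₁) / (2 * M))) * ‖f‖ := by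
  have hmain := ineq112_value_lp hM pos c m2 a q W T hc hq s hs S hS hS1 hSq W' T' hWW' hTT' Ω Gj hGj GjΩ hGjΩ G hGH
    G' hG'H good hn₀ hw hγ0 hβ0 hγ hγΩ h0 h0Ω hgr hgrΩ h2 h2Ω h3β x hR₀ F hD hD₀ hD₁ f hfF hV hfV
  have hentry : (mulH (ι := κ) (fun z => if z = x then (1 : ℝ) else 0) *ᵥ ((G - G') *ᵥ f)) (x, k)
      = ((G - G') *ᵥ f) (x, k) := by
    rw [mulH_mulVec_apply, if_pos rfl, one_mul]
  rw [← hentry, ← Real.norm_eq_abs]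
  exact (norm_le_pi_norm _ (x, k)).trans hmain

/-! ## §3. The δG chain for an arbitrary local probe -/

/-- **THE δG CHAIN FOR AN ARBITRARY LOCAL PROBE, GENERAL PAIR `Ω ⊂ Ω₀`, `R₀` IN LABEL FORM.**  Setting of
`ineq112_value_lp`; a PROBE `P` with `P·h_j = 0` off a set `S₀` of at most `m₀` cubes, all within `ρM` of `x₀`,
carrying the first-letter inputs `‖P·h_jG_jh_j‖, ‖P·h_jG_j^Ωh_j‖ ≤ α_P` on `S₀`; factor inputs for both families as in
`ineq112_value_lp`; `R₀`: the labels within `n₀` of `S₀` are good.  Then for `f` supported in `F × κ` with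
`‖f‖₂ ≤ V‖f‖_∞` and `D ≤ dist_∞(x₀,F)`, `D₀ ≤ dist_∞(x₀,Ω^c)`, `D₁ ≤ dist_∞(F,Ω^c)`:
`‖P((G_k(Ω,A) − G_k(Ω₀,A))f)‖_∞ ≤ 4m₀α_P·V·e^{ρ+29/8}·exp(−(D + D₀ + D₁)/(2M))·‖f‖_∞` (separation through a cube
meeting `Ω^c`: `⌊(D + D₀ + D₁)/(2M) − ρ − 21/8⌋`).  The derivative and Hölder members of the δG clause are its
instances. [cite: Balaban1983RegularityDecay, Theorem (1.11)–(1.12) p.573; p.579 after (2.22); Cor. 2.3 p.581] -/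
theorem probe_delta_bound_lp {M : ℝ} (hM : 0 < M) (pos : X → Fin d → ℝ) (c : X → X → ℝ) (m2 a : ℝ)
    (q : Y → X → ℝ) (W : X → X → Matrix κ κ ℝ) (T : Y → X → Matrix κ κ ℝ)
    (hc : ∀ x z', c x z' ≠ 0 → ∀ μ, |pos x μ - pos z' μ| ≤ 1 / 8 * M)
    (hq : ∀ y x z', q y x ≠ 0 → q y z' ≠ 0 → ∀ μ, |pos x μ - pos z' μ| ≤ 1 / 8 * M)
    (s : Finset (Fin d → ℤ)) (hs : ∀ j x, hCube M j (pos x) ≠ 0 → j ∈ s)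
    (S : (Fin d → ℤ) → X → Prop) [∀ j, DecidablePred (S j)]
    (hS : ∀ j z, (∀ μ, |pos z μ - M * j μ| ≤ 7 / 8 * M) → S j z)
    (hS1 : ∀ j z, S j z → ∀ μ, |pos z μ - M * j μ| ≤ M)
    (hSq : ∀ j y z z', q y z ≠ 0 → q y z' ≠ 0 → (S j z ↔ S j z'))
    (W' : (Fin d → ℤ) → X → X → Matrix κ κ ℝ) (T' : (Fin d → ℤ) → Y → X → Matrix κ κ ℝ)
    (hWW' : ∀ j x z', (∀ μ, |pos x μ - M * j μ| ≤ 3 / 4 * M) → (∀ μ, |pos z' μ - M * j μ| ≤ 3 / 4 * M) →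
      W' j x z' = W x z')
    (hTT' : ∀ j y x, q y x ≠ 0 → (∀ μ, |pos x μ - M * j μ| ≤ 3 / 4 * M) → T' j y x = T y x)
    (Ω : X → Prop) [DecidablePred Ω]
    (Gj : (Fin d → ℤ) → Matrix (X × κ) (X × κ) ℝ)
    (hGj : ∀ j ∈ s, covOp (fun z z' => if (S j z ↔ S j z') then c z z' else 0) m2 a q (W' j) (T' j) * Gj j = 1)
    (GjΩ : (Fin d → ℤ) → Matrix (X × κ) (X × κ) ℝ)
    (hGjΩ : ∀ j ∈ s, covOp (fun z z' => if (S j z ↔ S j z') then (if (Ω z ↔ Ω z') then c z z' else 0) else 0)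
      m2 a q (W' j) (T' j) * GjΩ j = 1)
    (G : Matrix (X × κ) (X × κ) ℝ) (hGH : G * covOp (fun z z' => if (Ω z ↔ Ω z') then c z z' else 0) m2 a q W T = 1)
    (G' : Matrix (X × κ) (X × κ) ℝ) (hG'H : G' * covOp c m2 a q W T = 1)
    -- the interior cubes and the per-cube analytic inputs for both families, in the printed norms
    -- the probe
    (P : Matrix (X × κ) (X × κ) ℝ) (S₀ : Finset ↥s) {m₀ : ℕ} (hcard : S₀.card ≤ m₀)
    (hP0 : ∀ i : ↥s, i ∉ S₀ → P * mulH (ι := κ) (fun z => hCube M i.1 (pos z)) = 0)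
    (x₀ : X) {ρ : ℝ} (hS₀ρ : ∀ i ∈ S₀, ∀ μ, |pos x₀ μ - M * i.1 μ| < ρ * M)
    (good : (Fin d → ℤ) → Prop) {αP β w : ℝ} {n₀ : ℕ} (hn₀ : 0 < n₀) (hw : 0 < w) (hαP0 : 0 ≤ αP) (hβ0 : 0 ≤ β)
    (hαP : ∀ i ∈ S₀, ‖P * (mulH (ι := κ) (fun z => hCube M i.1 (pos z)) * Gj i.1
        * mulH (ι := κ) (fun z => hCube M i.1 (pos z)))‖ ≤ αP)
    (hαPΩ : ∀ i ∈ S₀, ‖P * (mulH (ι := κ) (fun z => hCube M i.1 (pos z)) * GjΩ i.1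
        * mulH (ι := κ) (fun z => hCube M i.1 (pos z)))‖ ≤ αP)
    (h0 : ∀ i : ↥s, good i.1 → ‖opK (fun z z' => if (S i.1 z ↔ S i.1 z') then c z z' else 0) m2 a q (W' i.1) (T' i.1)
        (fun z => hCube M i.1 (pos z)) * Gj i.1 * mulH (ι := κ) (fun z => hCube M i.1 (pos z))‖ ≤ β)
    (h0Ω : ∀ i : ↥s, good i.1 → ‖opK (fun z z' => if (S i.1 z ↔ S i.1 z') then (if (Ω z ↔ Ω z') then c z z' else 0) else 0)
        m2 a q (W' i.1) (T' i.1) (fun z => hCube M i.1 (pos z)) * GjΩ i.1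
        * mulH (ι := κ) (fun z => hCube M i.1 (pos z))‖ ≤ β)
    (hgr : ∀ i : ↥s, good i.1 → ∀ t : ℕ, 1 ≤ t → t ≤ n₀ → ∀ g : X × κ → ℝ,
      lvl w n₀ (t - 1) ((opK (fun z z' => if (S i.1 z ↔ S i.1 z') then c z z' else 0) m2 a q (W' i.1) (T' i.1)
        (fun z => hCube M i.1 (pos z)) * Gj i.1 * mulH (ι := κ) (fun z => hCube M i.1 (pos z))) *ᵥ g) ≤ β * lvl w n₀ t g)
    (hgrΩ : ∀ i : ↥s, good i.1 → ∀ t : ℕ, 1 ≤ t → t ≤ n₀ → ∀ g : X × κ → ℝ,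
      lvl w n₀ (t - 1) ((opK (fun z z' => if (S i.1 z ↔ S i.1 z') then (if (Ω z ↔ Ω z') then c z z' else 0) else 0)
        m2 a q (W' i.1) (T' i.1) (fun z => hCube M i.1 (pos z)) * GjΩ i.1
        * mulH (ι := κ) (fun z => hCube M i.1 (pos z))) *ᵥ g) ≤ β * lvl w n₀ t g)
    (h2 : ∀ (i : ↥s) (g : X × κ → ℝ), lpv w 2 ((opK (fun z z' => if (S i.1 z ↔ S i.1 z') then c z z' else 0) m2 a q (W' i.1) (T' i.1)
        (fun z => hCube M i.1 (pos z)) * Gj i.1 * mulH (ι := κ) (fun z => hCube M i.1 (pos z))) *ᵥ g) ≤ β * lpv w 2 g)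
    (h2Ω : ∀ (i : ↥s) (g : X × κ → ℝ), lpv w 2 ((opK (fun z z' => if (S i.1 z ↔ S i.1 z') then (if (Ω z ↔ Ω z') then c z z' else 0) else 0)
        m2 a q (W' i.1) (T' i.1) (fun z => hCube M i.1 (pos z)) * GjΩ i.1
        * mulH (ι := κ) (fun z => hCube M i.1 (pos z))) *ᵥ g) ≤ β * lpv w 2 g)
    (h3β : (3 : ℝ) ^ d * β ≤ Real.exp (-1))
    -- the site with its `R₀` condition in label form, the support set, the three separations, the function
    (hR₀ : ∀ i ∈ S₀, ∀ j : ↥s, (∀ μ, |i.1 μ - j.1 μ| ≤ (n₀ : ℤ)) → good j.1)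
    (F : X → Prop) [DecidablePred F] {D D₀ D₁ : ℝ}
    (hD : ∀ x', F x' → ∃ μ, D ≤ |pos x₀ μ - pos x' μ|)
    (hD₀ : ∀ x₁, ¬ Ω x₁ → ∃ μ, D₀ ≤ |pos x₀ μ - pos x₁ μ|)
    (hD₁ : ∀ x', F x' → ∀ x₁, ¬ Ω x₁ → ∃ μ, D₁ ≤ |pos x₁ μ - pos x' μ|)
    (f : X × κ → ℝ) (hfF : ∀ p : X × κ, ¬ F p.1 → f p = 0) {V : ℝ} (hV : 1 ≤ V) (hfV : lpv w 2 f ≤ V * ‖f‖) :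
    ‖P *ᵥ ((G - G') *ᵥ f)‖
      ≤ 4 * m₀ * αP * V * Real.exp (ρ + 29 / 8) * Real.exp (-((D + D₀ + D₁) / (2 * M))) * ‖f‖ := by
  classical
  -- the letters of the two expansions
  set h : (Fin d → ℤ) → X → ℝ := fun j z => hCube M j (pos z) with hh
  set cΩ : X → X → ℝ := fun z z' => if (Ω z ↔ Ω z') then c z z' else 0 with hcΩ
  set cut : (Fin d → ℤ) → X → X → ℝ := fun j z z' => if (S j z ↔ S j z') then c z z' else 0 with hcut
  set cutΩ : (Fin d → ℤ) → X → X → ℝ := fun j z z' => if (S j z ↔ S j z') then cΩ z z' else 0 with hcutΩ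
  set aJ : (Fin d → ℤ) → Matrix (X × κ) (X × κ) ℝ :=
    fun j => mulH (ι := κ) (h j) * Gj j * mulH (ι := κ) (h j) with haJ
  set bJ : (Fin d → ℤ) → Matrix (X × κ) (X × κ) ℝ :=
    fun j => opK (cut j) m2 a q (W' j) (T' j) (h j) * Gj j * mulH (ι := κ) (h j) with hbJ
  set aΩ : (Fin d → ℤ) → Matrix (X × κ) (X × κ) ℝ :=
    fun j => mulH (ι := κ) (h j) * GjΩ j * mulH (ι := κ) (h j) with haΩ
  set bΩ : (Fin d → ℤ) → Matrix (X × κ) (X × κ) ℝ :=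
    fun j => opK (cutΩ j) m2 a q (W' j) (T' j) (h j) * GjΩ j * mulH (ι := κ) (h j) with hbΩ
  have hV0 : 0 ≤ V := zero_le_one.trans hV
  -- locality of the cut weights
  have hcΩloc : ∀ x z', cΩ x z' ≠ 0 → ∀ μ, |pos x μ - pos z' μ| ≤ 1 / 8 * M :=
    fun x z' hne μ => cut_local pos c Ω hc x z' hne μ
  have hM8 : 1 / 8 * M ≤ 3 / 4 * M := by nlinarith
  have hcut_loc : ∀ l z z', cut l z z' ≠ 0 → ∀ μ, |pos z μ - pos z' μ| ≤ 3 / 4 * M :=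
    fun l z z' hne μ => (cut_local pos c (S l) hc z z' hne μ).trans hM8
  have hcutΩ_loc : ∀ l z z', cutΩ l z z' ≠ 0 → ∀ μ, |pos z μ - pos z' μ| ≤ 3 / 4 * M :=
    fun l z z' hne μ => (cut_local pos cΩ (S l) hcΩloc z z' hne μ).trans hM8
  have hq_loc : ∀ y z z', q y z ≠ 0 → q y z' ≠ 0 → ∀ μ, |pos z μ - pos z' μ| ≤ 3 / 4 * M :=
    fun y z z' h1 h2 μ => (hq y z z' h1 h2 μ).trans hM8
  -- sizes of the letters
  have hh0 : ∀ j z, 0 ≤ h j z := fun j z => hCube_nonneg M j (pos z)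
  have hh1 : ∀ j z, |h j z| ≤ 1 := fun j z => abs_le.mpr ⟨by linarith [hh0 j z], hCube_le_one M j (pos z)⟩
  have hnH : ∀ j, ‖mulH (ι := κ) (h j)‖ ≤ 1 := fun j => norm_mulH_le _ zero_le_one (hh1 j)
  -- (2.9)–(2.12) for both propagators: `G′ = G₀ + G′R`, `G = G₀^Ω + GR^Ω`
  have h211 : covOp c m2 a q W T * ∑ j ∈ s, aJ j = 1 - ∑ j ∈ s, bJ j :=
    parametrix_identity_hCube hM pos c m2 a q W T s hs S hS hc hq W' T' hWW' hTT' Gj hGj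
  have h211Ω : covOp cΩ m2 a q W T * ∑ j ∈ s, aΩ j = 1 - ∑ j ∈ s, bΩ j :=
    parametrix_identity_hCube hM pos cΩ m2 a q W T s hs S hS hcΩloc hq W' T' hWW' hTT' GjΩ hGjΩ
  have hGeq : G' * (1 - ∑ j ∈ s, bJ j) = ∑ j ∈ s, aJ j := G_mul_one_sub_eq hG'H h211
  have hGeqΩ : G * (1 - ∑ j ∈ s, bΩ j) = ∑ j ∈ s, aΩ j := G_mul_one_sub_eq hGH h211Ω
  have hG'id : G' = ∑ j ∈ s, aJ j + G' * ∑ j ∈ s, bJ j := by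
    rw [← hGeq, mul_sub, mul_one]
    abel
  have hGid : G = ∑ j ∈ s, aΩ j + G * ∑ j ∈ s, bΩ j := by
    rw [← hGeqΩ, mul_sub, mul_one]
    abel
  -- interior cubes give identical letters: the two families agree off the cubes meeting `Ω^c`
  set TΩ : Finset ↥s := Finset.univ.filter fun j : ↥s => ∃ z, S j.1 z ∧ ¬ Ω z with hTΩ
  have hagree : ∀ j : ↥s, j ∉ TΩ → aΩ j.1 = aJ j.1 ∧ bΩ j.1 = bJ j.1 := by
    intro j hj
    have hSΩ : ∀ z, S j.1 z → Ω z := by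
      intro z hz
      by_contra hΩz
      exact hj (Finset.mem_filter.mpr ⟨Finset.mem_univ _, z, hz, hΩz⟩)
    have hsupp : ∀ z, h j.1 z ≠ 0 → S j.1 z := fun z hz =>
      hS j.1 z fun μ => (hCube_ne_zero_imp hM hz μ).le.trans (by nlinarith)
    have hag := interior_letters_agree c m2 a q (W' j.1) (T' j.1) (S j.1) Ω hSΩ (hSq j.1) (h j.1) hsupp
      (hGj j.1 j.2) (hGjΩ j.1 j.2)
    exact ⟨hag.1.symm, hag.2.symm⟩
  -- locality of the letters (non-neighbouring cubes)
  have hloc_gen : ∀ (cx : (Fin d → ℤ) → X → X → ℝ),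
      (∀ l z z', cx l z z' ≠ 0 → ∀ μ, |pos z μ - pos z' μ| ≤ 3 / 4 * M) →
      ∀ i l : ↥s, ¬ cubeAdj (fun i : ↥s => i.1) i l →
        mulH (ι := κ) (h i.1) * opK (cx l.1) m2 a q (W' l.1) (T' l.1) (h l.1) = 0 :=
    fun cx hcx i l hil => mulH_hCube_mul_opK_eq_zero hM pos (cx l.1) m2 a q (W' l.1) (T' l.1) (hcx l.1) hq_loc hil
  have hab_gen : ∀ (cx : (Fin d → ℤ) → X → X → ℝ) (Gx : (Fin d → ℤ) → Matrix (X × κ) (X × κ) ℝ),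
      (∀ l z z', cx l z z' ≠ 0 → ∀ μ, |pos z μ - pos z' μ| ≤ 3 / 4 * M) →
      ∀ i l : ↥s, ¬ cubeAdj (fun i : ↥s => i.1) i l →
        (mulH (ι := κ) (h i.1) * Gx i.1 * mulH (ι := κ) (h i.1))
          * (opK (cx l.1) m2 a q (W' l.1) (T' l.1) (h l.1) * Gx l.1 * mulH (ι := κ) (h l.1)) = 0 := by
    intro cx Gx hcx i l hil
    rw [show mulH (ι := κ) (h i.1) * Gx i.1 * mulH (ι := κ) (h i.1)
          * (opK (cx l.1) m2 a q (W' l.1) (T' l.1) (h l.1) * Gx l.1 * mulH (ι := κ) (h l.1))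
        = mulH (ι := κ) (h i.1) * Gx i.1
          * (mulH (ι := κ) (h i.1) * opK (cx l.1) m2 a q (W' l.1) (T' l.1) (h l.1))
          * Gx l.1 * mulH (ι := κ) (h l.1) by simp only [Matrix.mul_assoc],
      hloc_gen cx hcx i l hil, Matrix.mul_zero, Matrix.zero_mul, Matrix.zero_mul]
  have hbb_gen : ∀ (cx : (Fin d → ℤ) → X → X → ℝ) (Gx : (Fin d → ℤ) → Matrix (X × κ) (X × κ) ℝ),
      (∀ l z z', cx l z z' ≠ 0 → ∀ μ, |pos z μ - pos z' μ| ≤ 3 / 4 * M) →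
      ∀ i l : ↥s, ¬ cubeAdj (fun i : ↥s => i.1) i l →
        (opK (cx i.1) m2 a q (W' i.1) (T' i.1) (h i.1) * Gx i.1 * mulH (ι := κ) (h i.1))
          * (opK (cx l.1) m2 a q (W' l.1) (T' l.1) (h l.1) * Gx l.1 * mulH (ι := κ) (h l.1)) = 0 := by
    intro cx Gx hcx i l hil
    rw [show opK (cx i.1) m2 a q (W' i.1) (T' i.1) (h i.1) * Gx i.1 * mulH (ι := κ) (h i.1)
          * (opK (cx l.1) m2 a q (W' l.1) (T' l.1) (h l.1) * Gx l.1 * mulH (ι := κ) (h l.1))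
        = opK (cx i.1) m2 a q (W' i.1) (T' i.1) (h i.1) * Gx i.1
          * (mulH (ι := κ) (h i.1) * opK (cx l.1) m2 a q (W' l.1) (T' l.1) (h l.1))
          * Gx l.1 * mulH (ι := κ) (h l.1) by simp only [Matrix.mul_assoc],
      hloc_gen cx hcx i l hil, Matrix.mul_zero, Matrix.zero_mul, Matrix.zero_mul]
  -- the starting and the final cubes; the cut-offs on vectors
  set S₁ : Finset ↥s := Finset.univ.filter fun i : ↥s => ∃ x', F x' ∧ h i.1 x' ≠ 0 with hS₁
  have hP_gen : ∀ (Gx : Matrix (X × κ) (X × κ) ℝ) (i : ↥s), i ∉ S₀ →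
      P * (mulH (ι := κ) (h i.1) * Gx * mulH (ι := κ) (h i.1)) = 0 := by
    intro Gx i hi
    rw [← Matrix.mul_assoc, ← Matrix.mul_assoc, hP0 i hi, Matrix.zero_mul, Matrix.zero_mul]
  have hF0 : ∀ i : ↥s, i ∉ S₁ → mulH (ι := κ) (h i.1) *ᵥ f = 0 := by
    intro i hi
    funext p
    rw [mulH_mulVec_apply, Pi.zero_apply]
    by_cases hz : F p.1
    · have hiz : h i.1 p.1 = 0 := by
        by_contra hne
        exact hi (Finset.mem_filter.mpr ⟨Finset.mem_univ _, p.1, hz, hne⟩)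
      rw [hiz, zero_mul]
    · rw [hfF p hz, mul_zero]
  have hS₁_gen : ∀ (Kx Gx : Matrix (X × κ) (X × κ) ℝ) (i : ↥s), i ∉ S₁ →
      (Kx * Gx * mulH (ι := κ) (h i.1)) • f = 0 := by
    intro Kx Gx i hi
    rw [Matrix.smul_eq_mulVec, ← Matrix.mulVec_mulVec, hF0 i hi, Matrix.mulVec_zero]
  -- the probe functional `Φ(g) = ‖1_x ⊙ g‖_∞` on the two first-letter families
  have hS₀_gen : ∀ (Gx : (Fin d → ℤ) → Matrix (X × κ) (X × κ) ℝ) (i : ↥s), i ∉ S₀ → ∀ g : X × κ → ℝ,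
      ‖P *ᵥ ((mulH (ι := κ) (h i.1) * Gx i.1 * mulH (ι := κ) (h i.1)) • g)‖ ≤ 0 := by
    intro Gx i hi g
    rw [Matrix.smul_eq_mulVec, Matrix.mulVec_mulVec, hP_gen (Gx i.1) i hi, Matrix.zero_mulVec, norm_zero]
  have ha_gen : ∀ (Gx : (Fin d → ℤ) → Matrix (X × κ) (X × κ) ℝ),
      (∀ i ∈ S₀, ‖P * (mulH (ι := κ) (h i.1) * Gx i.1 * mulH (ι := κ) (h i.1))‖ ≤ αP) →
      ∀ i ∈ S₀, ∀ g : X × κ → ℝ,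
        ‖P *ᵥ ((mulH (ι := κ) (h i.1) * Gx i.1 * mulH (ι := κ) (h i.1)) • g)‖ ≤ αP * lvl w n₀ 0 g := by
    intro Gx hGx i hi g
    rw [Matrix.smul_eq_mulVec, Matrix.mulVec_mulVec, lvl_zero]
    exact (Matrix.linfty_opNorm_mulVec _ _).trans (mul_le_mul_of_nonneg_right (hGx i hi) (norm_nonneg _))
  -- the per-cube inputs in the abstract chain's format
  have hgr_gen : ∀ (bx : (Fin d → ℤ) → Matrix (X × κ) (X × κ) ℝ),
      (∀ i : ↥s, good i.1 → ∀ t : ℕ, 1 ≤ t → t ≤ n₀ → ∀ g : X × κ → ℝ,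
        lvl w n₀ (t - 1) (bx i.1 *ᵥ g) ≤ β * lvl w n₀ t g) →
      ∀ j : ↥s, good j.1 → ∀ t : ℕ, 1 ≤ t → t ≤ n₀ → ∀ g : X × κ → ℝ,
        lvl w n₀ (t - 1) (bx j.1 • g) ≤ β * lvl w n₀ t g := fun bx hbx j hj t ht1 ht2 g => by
    rw [Matrix.smul_eq_mulVec]
    exact hbx j hj t ht1 ht2 g
  have h2_gen : ∀ (bx : (Fin d → ℤ) → Matrix (X × κ) (X × κ) ℝ),
      (∀ (i : ↥s) (g : X × κ → ℝ), lpv w 2 (bx i.1 *ᵥ g) ≤ β * lpv w 2 g) →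
      ∀ (j : ↥s) (g : X × κ → ℝ), lvl w n₀ n₀ (bx j.1 • g) ≤ β * lvl w n₀ n₀ g := fun bx hbx j g => by
    rw [Matrix.smul_eq_mulVec, lvl_top w hn₀, lvl_top w hn₀]
    exact hbx j g
  have h0_gen : ∀ (bx : (Fin d → ℤ) → Matrix (X × κ) (X × κ) ℝ), (∀ i : ↥s, good i.1 → ‖bx i.1‖ ≤ β) →
      ∀ j : ↥s, good j.1 → ∀ g : X × κ → ℝ, lvl w n₀ 0 (bx j.1 • g) ≤ β * lvl w n₀ 0 g := fun bx hbx j hj g => by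
    rw [Matrix.smul_eq_mulVec, lvl_zero, lvl_zero]
    exact (Matrix.linfty_opNorm_mulVec _ _).trans (mul_le_mul_of_nonneg_right (hbx j hj) (norm_nonneg _))
  have h2inf' : lvl w n₀ n₀ f ≤ V * lvl w n₀ 0 f := by
    rw [lvl_top w hn₀, lvl_zero]
    exact hfV
  -- the separation THROUGH a cube meeting `Ω^c`: `N = ⌊(D + D₀ + D₁)/(2M) − 13/4⌋ ≥ r − 2`, `r = (D + D₀ + D₁)/(2M) − 9/4`
  set N : ℕ := ⌊(D + D₀ + D₁) / (2 * M) - ρ - 21 / 8⌋₊ with hNdef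
  have hN : ((D + D₀ + D₁) / (2 * M) - ρ - 13 / 8) - 2 ≤ (N : ℝ) := by
    have := Nat.sub_one_lt_floor ((D + D₀ + D₁) / (2 * M) - ρ - 21 / 8)
    linarith
  have hsep : ∀ i ∈ S₀, ∀ t ∈ TΩ, ∀ l ∈ S₁, ∃ μ ν, (N : ℤ) ≤ |i.1 μ - t.1 μ| + |t.1 ν - l.1 ν| := by
    intro i hi t ht l hl
    obtain ⟨-, x₁, hSx₁, hΩx₁⟩ := Finset.mem_filter.mp ht
    obtain ⟨-, x', hFx', hlx'⟩ := Finset.mem_filter.mp hl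
    by_cases hSig : 0 ≤ (D + D₀ + D₁) / (2 * M) - ρ - 21 / 8
    · have hNle : (N : ℝ) ≤ (D + D₀ + D₁) / (2 * M) - ρ - 21 / 8 := Nat.floor_le hSig
      have hNM : ((N : ℝ) + ρ + 21 / 8) * M ≤ (D + D₀ + D₁) / 2 := by
        have : (N : ℝ) + ρ + 21 / 8 ≤ (D + D₀ + D₁) / 2 / M := by rw [div_div]; linarith
        rwa [le_div_iff₀ hM] at this
      have hi5 : ∀ μ, |pos x₀ μ - M * i.1 μ| < ρ * M := hS₀ρ i hi
      have ht1 : ∀ μ, |pos x₁ μ - M * t.1 μ| ≤ M := hS1 t.1 x₁ hSx₁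
      have hl5 : ∀ μ, |pos x' μ - M * l.1 μ| < 5 / 8 * M := hCube_ne_zero_imp hM hlx'
      have hit : ∀ μ, |pos x₀ μ - pos x₁ μ| - (ρ + 1) * M < M * |((i.1 μ : ℤ) : ℝ) - t.1 μ| := by
        intro μ
        have htri : |pos x₀ μ - pos x₁ μ|
            ≤ |pos x₀ μ - M * i.1 μ| + |M * i.1 μ - M * t.1 μ| + |pos x₁ μ - M * t.1 μ| := by
          calc |pos x₀ μ - pos x₁ μ|
              = |(pos x₀ μ - M * i.1 μ) + (M * i.1 μ - M * t.1 μ) + (M * t.1 μ - pos x₁ μ)| := by ring_nf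
            _ ≤ |pos x₀ μ - M * i.1 μ| + |M * i.1 μ - M * t.1 μ| + |M * t.1 μ - pos x₁ μ| := abs_add_three _ _ _
            _ = _ := by rw [abs_sub_comm (M * t.1 μ) (pos x₁ μ)]
        rw [← mul_sub, abs_mul, abs_of_pos hM] at htri
        nlinarith [hi5 μ, ht1 μ]
      have htl : ∀ ν, |pos x₁ ν - pos x' ν| - 13 / 8 * M < M * |((t.1 ν : ℤ) : ℝ) - l.1 ν| := by
        intro ν
        have htri : |pos x₁ ν - pos x' ν|
            ≤ |pos x₁ ν - M * t.1 ν| + |M * t.1 ν - M * l.1 ν| + |pos x' ν - M * l.1 ν| := by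
          calc |pos x₁ ν - pos x' ν|
              = |(pos x₁ ν - M * t.1 ν) + (M * t.1 ν - M * l.1 ν) + (M * l.1 ν - pos x' ν)| := by ring_nf
            _ ≤ |pos x₁ ν - M * t.1 ν| + |M * t.1 ν - M * l.1 ν| + |M * l.1 ν - pos x' ν| := abs_add_three _ _ _
            _ = _ := by rw [abs_sub_comm (M * l.1 ν) (pos x' ν)]
        rw [← mul_sub, abs_mul, abs_of_pos hM] at htri
        linarith [ht1 ν, hl5 ν]
      have key : ∃ μ ν, (D + D₀ + D₁) / 2 ≤ |pos x₀ μ - pos x₁ μ| + |pos x₁ ν - pos x' ν| := by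
        by_cases hcase : D ≤ D₀ + D₁
        · obtain ⟨μ, hμ⟩ := hD₀ x₁ hΩx₁
          obtain ⟨ν, hν⟩ := hD₁ x' hFx' x₁ hΩx₁
          exact ⟨μ, ν, by linarith⟩
        · obtain ⟨μ, hμ⟩ := hD x' hFx'
          refine ⟨μ, μ, ?_⟩
          have htri : |pos x₀ μ - pos x' μ| ≤ |pos x₀ μ - pos x₁ μ| + |pos x₁ μ - pos x' μ| := by
            calc |pos x₀ μ - pos x' μ| = |(pos x₀ μ - pos x₁ μ) + (pos x₁ μ - pos x' μ)| := by ring_nf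
              _ ≤ _ := abs_add_le _ _
          linarith
      obtain ⟨μ, ν, hμν⟩ := key
      refine ⟨μ, ν, ?_⟩
      have hsum' : (N : ℝ) * M < M * |((i.1 μ : ℤ) : ℝ) - t.1 μ| + M * |((t.1 ν : ℤ) : ℝ) - l.1 ν| := by
        nlinarith [hit μ, htl ν]
      rw [← mul_add] at hsum'
      have h5 : (N : ℝ) < |((i.1 μ : ℤ) : ℝ) - t.1 μ| + |((t.1 ν : ℤ) : ℝ) - l.1 ν| := by
        by_contra hle
        rw [not_lt] at hle
        have := mul_le_mul_of_nonneg_left hle hM.le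
        linarith
      have h6 : ((N : ℤ) : ℝ) < ((|i.1 μ - t.1 μ| + |t.1 ν - l.1 ν| : ℤ) : ℝ) := by push_cast; exact h5
      exact (Int.cast_lt.mp h6).le
    · have hN0 : N = 0 := Nat.floor_eq_zero.mpr (by linarith)
      obtain ⟨μ, -⟩ := hD x' hFx'
      refine ⟨μ, μ, ?_⟩
      rw [hN0]
      positivity
  -- BOTH REMAINDERS DECAY: `‖1_x ⊙ (G₁R₁^m f)‖_∞ ≤ ‖G₁‖(2^dβ)^m‖f‖₂/√w`, `2^dβ ≤ 1/2`
  have hθ : (2 : ℝ) ^ d * β ≤ 1 / 2 :=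
    ((mul_le_mul_of_nonneg_right (pow_le_pow_left₀ (by norm_num) (by norm_num) d) hβ0).trans h3β).trans
      exp_neg_one_le_half
  have hrem_gen : ∀ (G₁ Rx : Matrix (X × κ) (X × κ) ℝ),
      (∀ m : ℕ, lpv w 2 ((Rx ^ m) *ᵥ f) ≤ ((2 : ℝ) ^ d * β) ^ m * lpv w 2 f) →
      ∀ m : ℕ, ‖P *ᵥ ((G₁ * Rx ^ m) • f)‖ ≤ (1 / 2 : ℝ) ^ m * (‖P * G₁‖ * (lpv w 2 f / Real.sqrt w)) := by
    intro G₁ Rx hRx m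
    rw [Matrix.smul_eq_mulVec, ← Matrix.mulVec_mulVec, Matrix.mulVec_mulVec]
    have hC0 : 0 ≤ ‖P * G₁‖ * (lpv w 2 f / Real.sqrt w) :=
      mul_nonneg (norm_nonneg _) (div_nonneg (lpv_nonneg hw.le 2 f) (Real.sqrt_nonneg _))
    calc ‖(P * G₁) *ᵥ ((Rx ^ m) *ᵥ f)‖ ≤ ‖P * G₁‖ * ‖(Rx ^ m) *ᵥ f‖ := Matrix.linfty_opNorm_mulVec _ _
      _ ≤ ‖P * G₁‖ * (lpv w 2 ((Rx ^ m) *ᵥ f) / Real.sqrt w) :=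
          mul_le_mul_of_nonneg_left (norm_le_lpv_two hw _) (norm_nonneg _)
      _ ≤ ‖P * G₁‖ * ((((2 : ℝ) ^ d * β) ^ m * lpv w 2 f) / Real.sqrt w) := by
          gcongr
          exact hRx m
      _ = ((2 : ℝ) ^ d * β) ^ m * (‖P * G₁‖ * (lpv w 2 f / Real.sqrt w)) := by ring
      _ ≤ (1 / 2 : ℝ) ^ m * (‖P * G₁‖ * (lpv w 2 f / Real.sqrt w)) :=
          mul_le_mul_of_nonneg_right (pow_le_pow_left₀ (by positivity) hθ m) hC0
  have hrem : ∀ ε : ℝ, 0 < ε → ∃ m : ℕ, ‖P *ᵥ ((G * (∑ j ∈ s, bΩ j) ^ m) • f)‖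
      + ‖P *ᵥ ((G' * (∑ j ∈ s, bJ j) ^ m) • f)‖ ≤ ε := by
    intro ε hε
    set C : ℝ := ‖P * G‖ * (lpv w 2 f / Real.sqrt w) + ‖P * G'‖ * (lpv w 2 f / Real.sqrt w) with hC
    have hq0 : 0 ≤ lpv w 2 f / Real.sqrt w := div_nonneg (lpv_nonneg hw.le 2 f) (Real.sqrt_nonneg _)
    have hC0 : 0 ≤ C := add_nonneg (mul_nonneg (norm_nonneg _) hq0) (mul_nonneg (norm_nonneg _) hq0)
    obtain ⟨m, hm⟩ := exists_pow_lt_of_lt_one (show 0 < ε / (C + 1) by positivity) (show (1 / 2 : ℝ) < 1 by norm_num)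
    refine ⟨m, ?_⟩
    rw [lt_div_iff₀ (by positivity)] at hm
    have h1 := hrem_gen G (∑ j ∈ s, bΩ j)
      (fun m => lpv_two_R_pow_mulVec_le hM pos cΩ m2 a q hcΩloc hq s S W' T' GjΩ hβ0 hw h2Ω f m) m
    have h2r := hrem_gen G' (∑ j ∈ s, bJ j)
      (fun m => lpv_two_R_pow_mulVec_le hM pos c m2 a q hc hq s S W' T' Gj hβ0 hw h2 f m) m
    calc _ ≤ (1 / 2 : ℝ) ^ m * (‖P * G‖ * (lpv w 2 f / Real.sqrt w))
          + (1 / 2 : ℝ) ^ m * (‖P * G'‖ * (lpv w 2 f / Real.sqrt w)) := add_le_add h1 h2r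
      _ = (1 / 2 : ℝ) ^ m * C := by rw [hC]; ring
      _ ≤ (1 / 2 : ℝ) ^ m * (C + 1) := by gcongr; linarith
      _ ≤ ε := hm.le
  -- the abstract cancellation bound through the chain
  have hmain := lattice_lp_walk_delta_bound_rem (R := Matrix (X × κ) (X × κ) ℝ) (E := X × κ → ℝ)
    (fun i : ↥s => i.1) Subtype.val_injective
    (a := fun i : ↥s => aΩ i.1) (b := fun i : ↥s => bΩ i.1) (a' := fun i : ↥s => aJ i.1) (b' := fun i : ↥s => bJ i.1)
    (G := G) (G' := G') (f := f) (Φ := fun g => ‖P *ᵥ g‖) (nrm := lvl w n₀) (good := fun i : ↥s => good i.1)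
    (S₀ := S₀) (S₁ := S₁) (T := TΩ) (c₁ := αP) (β := β) (r := (D + D₀ + D₁) / (2 * M) - ρ - 13 / 8) (N := N)
    (n₀ := n₀) (V := V)
    (by rw [Finset.sum_coe_sort s aΩ]) (by rw [Finset.sum_coe_sort s bΩ])
    (by rw [Finset.sum_coe_sort s aJ]) (by rw [Finset.sum_coe_sort s bJ]) hGid hG'id hrem
    (hab_gen cutΩ GjΩ hcutΩ_loc) (hbb_gen cutΩ GjΩ hcutΩ_loc) (hab_gen cut Gj hcut_loc) (hbb_gen cut Gj hcut_loc)
    (fun i hi => (hagree i hi).1) (fun i hi => (hagree i hi).2)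
    (by simp) (fun u v => by simpa [Matrix.mulVec_add] using norm_add_le (P *ᵥ u) (P *ᵥ v))
    (fun u v => by simpa [Matrix.mulVec_sub] using norm_sub_le (P *ᵥ u) (P *ᵥ v))
    (hS₀_gen GjΩ) (hS₀_gen Gj)
    (fun i hi => hS₁_gen _ _ i hi) (fun i hi => hS₁_gen _ _ i hi)
    (fun i hi => hS₁_gen _ _ i hi) (fun i hi => hS₁_gen _ _ i hi)
    hαP0 (ha_gen GjΩ hαPΩ) (ha_gen Gj hαP) hβ0
    (hgr_gen bΩ hgrΩ) (h2_gen bΩ h2Ω) (h0_gen bΩ h0Ω) (hgr_gen bJ hgr) (h2_gen bJ h2) (h0_gen bJ h0)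
    hV h2inf' (by rw [lvl_zero]; exact norm_nonneg _) hR₀ h3β hsep hN
  simp only [Matrix.smul_eq_mulVec, lvl_zero] at hmain
  -- the exponent bookkeeping
  have hexp : Real.exp 2 * Real.exp (-((D + D₀ + D₁) / (2 * M) - ρ - 13 / 8))
      = Real.exp (ρ + 29 / 8) * Real.exp (-((D + D₀ + D₁) / (2 * M))) := by
    rw [← Real.exp_add, ← Real.exp_add]
    congr 1
    ring
  calc ‖P *ᵥ ((G - G') *ᵥ f)‖
      ≤ 4 * S₀.card * αP * V * Real.exp 2 * Real.exp (-((D + D₀ + D₁) / (2 * M) - ρ - 13 / 8)) * ‖f‖ := hmain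
    _ ≤ 4 * (m₀ : ℝ) * αP * V * Real.exp 2 * Real.exp (-((D + D₀ + D₁) / (2 * M) - ρ - 13 / 8)) * ‖f‖ := by
        gcongr
    _ = 4 * (m₀ : ℝ) * αP * V * (Real.exp 2 * Real.exp (-((D + D₀ + D₁) / (2 * M) - ρ - 13 / 8))) * ‖f‖ := by
        ring
    _ = 4 * m₀ * αP * V * Real.exp (ρ + 29 / 8) * Real.exp (-((D + D₀ + D₁) / (2 * M))) * ‖f‖ := by
        rw [hexp]; ring

end Route

end Literature.MathematicalPhysics.QuantumFieldTheory.Balaban1983to89.B4Ineq112LpChain
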